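import Summits.CriticalPhenomena.SAWScalingLimit.Theses.SAWRenewalTightness
import Summits.CriticalPhenomena.SAWScalingLimit.Theses.SAWWeldingIdentification
import Summits.CriticalPhenomena.SAWScalingLimit.Theorems.SAWParafermionTightRefutation
import Summits.CriticalPhenomena.SAWScalingLimit.Theorems.SubseqIdentification.Negative.CoincidentEndpointLaw
import Summits.CriticalPhenomena.SAWScalingLimit.Theorems.SubseqIdentification.Negative.Necessity
import Summits.CriticalPhenomena.SAWScalingLimit.Theorems.ShellCrossingBound.Negative.OfEventualTight
import Summits.CriticalPhenomena.SAWScalingLimit.Theorems.ShellCrossingBound.Negative.Forcing6Shell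
import Summits.CriticalPhenomena.SAWScalingLimit.Theses.SAWTwistedSelfEnergy
import Summits.CriticalPhenomena.SAWScalingLimit.Theorems.EventualTight.Negative.TightnessNecessary
import Summits.CriticalPhenomena.SAWScalingLimit.Theorems.EventualTight.Negative.AlongMeshEndpointLimitsFalse

/-!
# Disproof work file — crux `EventualTight` (stmt-CriticalPhenomena-1372 set form / stmt-CriticalPhenomena-1881 along the mesh), cdisprove generations 1–2

The crux (route `SAWRenewalTightness`, rank 0; the SAME decl body is the `EventualTight` of
`SAWWeldingIdentification`, `SAWEdgeOfPositiveType`, `SAWChargeContinuation`, `SAWFrontierHomotopy`,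
`SAWRestrictionRigidity`, `SAWLoopFugacityFlow`, `SAWSteinDefect`, `SAWRingGibbsDescent`, `SAWTensorRG`,
`SAWStochasticQuantisation` — the ledger dedups them as stmt-1372):

  `EventualTight : ∀ (D : DobrushinDomain) (a b : ℝ → Site 2), SAW.IsEndpointApprox D a b →
      ∃ δ₀ > 0, IsTightMeasureSet ((fun δ ↦ (SAW.law D.carrier δ (a δ) (b δ)).map curve) '' Ioc 0 δ₀)`

i.e. tightness, on the Polish space `CurveClass ℂ` of curves modulo reparametrisation, of the
critical square-lattice SAW laws of Lawler–Schramm–Werner / Duminil-Copin–Smirnov on an initial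
mesh interval — the repaired (`∃ δ₀`) form of the refuted all-`δ` statement stmt-0772.

## Findings (index; every claim is a checked theorem of this file unless marked NEAR-MISS)

* §0 `dedup` — `crux_iff_welding`: the two route copies named in this unit are syntactically equal
  (`Iff.rfl`); the twins stmt-1881 (along the mesh) / stmt-4922 are equivalent to the crux
  (`Cruxes/HexTight/Disproof.lean` §5, `z2_setForm_iff_alongMesh`, refuter cdisprove-5423).
* §1 `junk regimes` — every junk value of the formalisation HELPS the statement: the law is `0` or a
  probability measure (`law_eq_zero_or_isProbabilityMeasure`), `0` as soon as `a δ, b δ` are not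
  joined (`law_eq_zero_of_not_reachable`), and a family of zero laws is tight
  (`isTightMeasureSet_image_of_forall_not_reachable`): the field `IsEndpointApprox.reachable` is
  NOT load-bearing for tightness (it only makes the laws honest probability measures).
* §2 `load-bearing` — the endpoint limits `tendsto_fst` / `tendsto_snd` ARE load-bearing, through
  the loophole that `DomainSAW Ω δ w w ∋ nil` for EVERY site `w` (also outside `Ω_δ`), so that the
  law between coincident endpoints is the Dirac mass at a constant curve wherever `w` sits:
  `eventualTight_false_without_endpointLimits` (unit disc, `a δ = b δ = far δ = (⌈δ⁻²⌉₊, 0)`,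
  `‖δ · far δ‖ ≥ δ⁻¹ → ∞` as `δ → 0⁺` INSIDE every `(0, δ₀]`; `CurveClass.source` is continuous).
* §3 `strengthenings` — three natural strengthenings, each implying the crux, each FALSE:
  S1 `CruxAllMeshes` (`δ ∈ (0,1]`, = stmt-0772 verbatim: `cruxAllMeshes_iff_tight`,
  `not_cruxAllMeshes` from the in-tree `SAWParafermionTight_refuted`);
  S2 `CruxUniformThreshold` (`∀ D ∃ δ₀ ∀ a b` — the quantifier swap): `not_cruxUniformThreshold`,
  by SPLICING the honest unit-disc approximation `isEndpointApprox_std` below `δ₀/2` with far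
  coincident endpoints on `(δ₀/2, δ₀]`;
  S3 `CruxUniformDomains` (`∃ δ₀ ∀ D a b`): `not_cruxUniformDomains`.
  MORAL: the threshold `δ₀` must depend on the approximation `(a, b)`, not only on `D`.
* §4 `why it resists` (theorem `resists`, docstring = attack log): the crux is NECESSARY for the summit conjunct
  (`SAWScalingLimit → EventualTight`, proved in `Cruxes/SubseqIdentification/Disproof.lean` §6 by
  refuter cdisprove-0783 — a kill here kills the LSW conjecture as typed and every SAW route), it is
  EQUIVALENT to the sibling crux `ShellCrossingBound` (landed
  `Theorems/ShellCrossingBound/Negative/OfEventualTight.lean` + support `TightOfShellCrossing`),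
  positive meshes are free (window compactness, landed
  `Theorems/SubseqIdentification/Negative/CompactContainerZd.lean`), and in the honest regime
  (`a δ ≠ b δ` joined) every curve is confined to `closure Ω`
  (`Theorems/SubseqIdentification/Negative/Necessity.lean`, `range_curve_subset_closure`): an
  honest counterexample must be an OSCILLATION failure of the critical `ℤ²` SAW along `δ → 0`,
  i.e. a disproof of Aizenman–Burchard regularity (H1) / Kemppainen–Smirnov G2 for `x_c`-SAW —
  contradicting SLE(8/3); no mechanism known.
* §5 `boundary regularity is load-bearing` — `eventualTight_false_without_jordan : ¬ CruxOverDomains`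
  (sorry-free, std axioms): over bounded open CONNECTED `Ω` with two marked FRONTIER points (all the
  `DobrushinDomain` fields except the Jordan boundary loop) the statement is FALSE. Witness: the dyadic
  SNAKE `Snake.Ω` (frontier ⊇ `{0} × [0,1]`, not locally connected), honest endpoints `a δ → 0`,
  `b δ → 5/8` joined in `Ω_δ` (largest component settled by counting); EVERY SAW traverses the FIXED
  shell `D((1/2,0); 3/5, 7/10)` `K δ / 2 → ∞` times (`Snake.forcing`, IVT across the walls), which no
  compact set of curve classes allows (`exists_forall_not_hasTraversals_of_isCompact`; packaged as
  `Snake.escapes`; the along-the-mesh form of the twin stmt-1881 fails too: `tightAlongMesh_false_without_jordan`). MORAL for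
  provers: any proof of the crux must USE the boundary loop of `D` (local connectivity of `∂Ω` at the
  marked points: it bounds the number of FORCED traversals per fixed shell); `isOpen`, `isBounded`,
  `isConnected`, `pt i ∈ frontier`, `pt 0 ≠ pt 1` and `IsEndpointApprox` together do NOT suffice. This is
  exactly where the shell-dependent threshold `k x ρ R` of the sibling crux `ShellCrossingBound` must
  absorb the boundary (cf. `Theorems/ShellCrossingBound/Negative/UniformThresholdFalse.lean`: for a
  JORDAN domain the forced count per shell is finite but unbounded over shrinking shells; here, without
  the loop, it is unbounded for ONE shell).
* §6 `unit cdisprove-1881` (the ALONG-THE-MESH twin stmt-1881, bet route SAWTwistedSelfEnergy; cycle 1,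
  2026-08-17) — by name: `crux1881_of_crux` / `crux_of_crux1881` (the two forms are equivalent),
  `crux1881_necessary` / `not_summit_of_not_crux1881` (`SAWScalingLimit → Crux1881`); and the picked
  line's atom `UMA` (card unordered-markov-fibres, `SketchIdeator2_1881.lean`, restated verbatim in
  `UMALine`): `event_eq_empty_of_budget_le_two` (coarse budget `m ≤ 2` is vacuous for rim-outside
  endpoints — content starts at "exactly one dive"), `topScale_of_crux1881` (the instances with
  `Ω ⊆ B(y,2s)` are exactly per-shell tightness and follow from the crux: `UMA → crux → UMA∣top`),
  `uma_resists` (attack log: no fibre FORCES the bad event for a fixed Jordan domain, with or without the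
  budget; the budget only defuses ENTROPIC multi-door forcing; the residue is multi-strand AB-regularity
  uniform over lattice-pinned boundary data ⊇ `PureDiscChordTight`).
-/

noncomputable section

open MeasureTheory Filter Topology Set Metric
open Literature.Probability.RandomPlanarGeometry Literature.Probability.RandomPlanarGeometry.SAW
  Literature.Probability.LatticeModels
open scoped ENNReal NNReal unitInterval

namespace Summit.CriticalPhenomena.SAWScalingLimit.Cruxes.EventualTight.Disproof

open Summit.CriticalPhenomena.SAWScalingLimit.Theorems.SubseqIdentification.Negative
  (law_self curve_nil isEndpointApprox_std isEndpointApprox_congr)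
open Summit.CriticalPhenomena.SAWScalingLimit.Theorems.ShellCrossingBound.Negative
  (exists_forall_not_hasTraversals_of_isCompact)
open Summit.CriticalPhenomena.SAWScalingLimit.Theorems.ShellCrossingBound.Negative.Forcing
  (meshPoint_vec vec_add_single_zero vec_add_single_one eq_vec exists_chain chain_lt
    range_toCurve_subset toCurve_apply_one isProbabilityMeasure_law abs_im_sub_le_dist)

/-! ## §0 The crux by name; dedup -/

/-- The crux under attack, by name (route `SAWRenewalTightness`). -/
abbrev Crux : Prop := Summit.CriticalPhenomena.SAWScalingLimit.Theses.SAWRenewalTightness.EventualTight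

/-- The copy in route `SAWWeldingIdentification` is syntactically the same statement. [folklore] -/
theorem crux_iff_welding :
    Crux ↔ Summit.CriticalPhenomena.SAWScalingLimit.Theses.SAWWeldingIdentification.EventualTight :=
  Iff.rfl

/-- The pushed-forward critical SAW laws on the curve space, as a family in the mesh. -/
def laws (Ω : Set ℂ) (a b : ℝ → Site 2) (δ : ℝ) : Measure (CurveClass ℂ) :=
  (law Ω δ (a δ) (b δ)).map (fun γ => γ.curve)

/-- The crux, unfolded through `laws`. [folklore] -/
theorem crux_iff : Crux ↔ ∀ (D : DobrushinDomain) (a b : ℝ → Site 2), IsEndpointApprox D a b →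
    ∃ δ₀ : ℝ, 0 < δ₀ ∧ IsTightMeasureSet (laws D.carrier a b '' Set.Ioc 0 δ₀) :=
  Iff.rfl

/-! ## §1 Junk regimes favour the statement -/

section Junk

variable {Ω : Set ℂ} {δ : ℝ} {a b : Site 2}

/-- No walk from `a` to `b` in `Ω_δ` ⇒ no SAW. [folklore] -/
theorem isEmpty_domainSAW_of_not_reachable (h : ¬ (discreteDomainGraph Ω δ).Reachable a b) :
    IsEmpty (DomainSAW Ω δ a b) :=
  ⟨fun γ => h ⟨γ.walk⟩⟩

/-- No walk from `a` to `b` in `Ω_δ` ⇒ the critical SAW law is the ZERO measure (junk value),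
which satisfies every tightness inequality. [folklore] -/
theorem law_eq_zero_of_not_reachable (h : ¬ (discreteDomainGraph Ω δ).Reachable a b) :
    law Ω δ a b = 0 := by
  haveI := isEmpty_domainSAW_of_not_reachable h
  exact Measure.eq_zero_of_isEmpty _

/-- The law is ALWAYS either `0` or a probability measure (total weight `0`, `∞` ↦ `0`). [folklore] -/
theorem law_eq_zero_or_isProbabilityMeasure (Ω : Set ℂ) (δ : ℝ) (a b : Site 2) :
    law Ω δ a b = 0 ∨ IsProbabilityMeasure (law Ω δ a b) := by
  rcases Summit.CriticalPhenomena.SAWScalingLimit.Theorems.SubseqIdentification.Negative.isProbabilityMeasure_law_or_eq_zero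
    Ω δ a b with h | h
  · exact Or.inr h
  · exact Or.inl h

/-- Hence no pushed law has mass `> 1`: tightness can only fail by ESCAPE of mass, never by excess. [folklore] -/
theorem laws_apply_le_one (Ω : Set ℂ) (a b : ℝ → Site 2) (δ : ℝ) (s : Set (CurveClass ℂ)) :
    laws Ω a b δ s ≤ 1 := by
  rcases law_eq_zero_or_isProbabilityMeasure Ω δ (a δ) (b δ) with h | h
  · simp [laws, h]
  · unfold laws
    haveI := h
    haveI : IsProbabilityMeasure ((law Ω δ (a δ) (b δ)).map fun γ => γ.curve) :=
      Measure.isProbabilityMeasure_map (aemeasurable_curve _ _ _ _)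
    exact prob_le_one

/-- A family of laws between UNJOINED endpoints is tight (all laws are `0`): the field
`IsEndpointApprox.reachable` is not what makes the crux hard. [folklore] -/
theorem isTightMeasureSet_image_of_forall_not_reachable (a b : ℝ → Site 2) {T : Set ℝ}
    (h : ∀ δ ∈ T, ¬ (discreteDomainGraph Ω δ).Reachable (a δ) (b δ)) :
    IsTightMeasureSet (laws Ω a b '' T) := by
  rw [isTightMeasureSet_iff_exists_isCompact_measure_compl_le]
  intro ε _
  refine ⟨∅, isCompact_empty, ?_⟩
  rintro μ ⟨δ, hδ, rfl⟩
  simp [laws, law_eq_zero_of_not_reachable (h δ hδ)]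

end Junk

/-! ## §2 Load-bearing hypotheses: the endpoint limits -/

section EndpointLimits

/-- Mesh points on the real axis. [folklore] -/
theorem meshPoint_axis (δ : ℝ) (m : ℤ) : meshPoint δ ![m, 0] = ((δ * m : ℝ) : ℂ) :=
  Complex.ext (by simp) (by simp)

/-- Far-away sites `far δ = (⌈δ⁻²⌉₊, 0)`: coincident endpoints there escape every compact set. -/
def far (δ : ℝ) : Site 2 := ![((⌈δ⁻¹ ^ 2⌉₊ : ℕ) : ℤ), 0]

/-- `‖δ · far t‖ = δ ⌈t⁻²⌉₊`. [folklore] -/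
theorem norm_meshPoint_far {δ : ℝ} (hδ : 0 ≤ δ) (t : ℝ) :
    ‖meshPoint δ (far t)‖ = δ * (⌈t⁻¹ ^ 2⌉₊ : ℝ) := by
  rw [far, meshPoint_axis, Complex.norm_real, Real.norm_eq_abs]
  push_cast
  rw [abs_of_nonneg (by positivity)]

/-- `‖δ · far t‖ ≥ δ t⁻²`. [folklore] -/
theorem le_norm_meshPoint_far {δ t : ℝ} (hδ : 0 ≤ δ) :
    δ * t⁻¹ ^ 2 ≤ ‖meshPoint δ (far t)‖ := by
  rw [norm_meshPoint_far hδ]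
  exact mul_le_mul_of_nonneg_left (Nat.le_ceil _) hδ

/-- `‖δ · far δ‖ ≥ δ⁻¹`. [folklore] -/
theorem inv_le_norm_meshPoint_far {δ : ℝ} (hδ : 0 < δ) : δ⁻¹ ≤ ‖meshPoint δ (far δ)‖ := by
  refine le_trans (le_of_eq ?_) (le_norm_meshPoint_far (t := δ) hδ.le)
  rw [sq, ← mul_assoc, mul_inv_cancel₀ hδ.ne', one_mul]

/-- The pushed law between COINCIDENT endpoints is the Dirac mass at the constant class at `δ·w`
(for every `Ω`, every `δ`, every site `w` — also OUTSIDE `Ω_δ`: the trivial walk needs no edge).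
[folklore] -/
theorem laws_coincident (Ω : Set ℂ) {a b : ℝ → Site 2} {δ : ℝ} {w : Site 2} (ha : a δ = w)
    (hb : b δ = w) : laws Ω a b δ = Measure.dirac (CurveClass.mk (Curve.const (meshPoint δ w))) := by
  unfold laws
  rw [ha, hb, law_self, Measure.map_dirac' (DomainSAW.measurable_of_top _), curve_nil]

/-- A Dirac law at a constant class outside `K` gives `K` no mass: `Kᶜ` has mass `1`. [folklore] -/
theorem dirac_compl_eq_one {K : Set (CurveClass ℂ)} (hK : IsClosed K) {c : CurveClass ℂ}
    (hc : c ∉ K) : Measure.dirac c Kᶜ = 1 := by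
  rw [Measure.dirac_apply' _ hK.measurableSet.compl, Set.indicator_of_mem (Set.mem_compl hc),
    Pi.one_apply]

/-- On a compact set of curve classes the starting points are bounded. [folklore] -/
theorem exists_bound_source_of_isCompact {K : Set (CurveClass ℂ)} (hK : IsCompact K) :
    ∃ R : ℝ, 0 ≤ R ∧ ∀ c ∈ K, ‖c.source‖ ≤ R := by
  obtain ⟨R, hR⟩ := (isBounded_iff_subset_closedBall 0).1
    (hK.image CurveClass.continuous_source).isBounded
  refine ⟨max R 0, le_max_right _ _, fun c hc => ?_⟩
  have := hR (mem_image_of_mem _ hc)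
  rw [mem_closedBall, dist_zero_right] at this
  exact this.trans (le_max_left _ _)

/-- The crux with the endpoint LIMITS dropped from `IsEndpointApprox` (only `reachable` kept). -/
def CruxWithoutEndpointLimits : Prop :=
  ∀ (D : DobrushinDomain) (a b : ℝ → Site 2),
    (∀ᶠ δ in 𝓝[>] (0 : ℝ), (discreteDomainGraph D.carrier δ).Reachable (a δ) (b δ)) →
    ∃ δ₀ : ℝ, 0 < δ₀ ∧ IsTightMeasureSet (laws D.carrier a b '' Set.Ioc 0 δ₀)

/-- It implies the crux (it has fewer hypotheses). [folklore] -/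
theorem crux_of_withoutEndpointLimits (h : CruxWithoutEndpointLimits) : Crux :=
  fun D a b hab => h D a b hab.reachable

/-- **The endpoint limits are load-bearing**: without `tendsto_fst` / `tendsto_snd` the statement is
FALSE. Witness: the unit disc and the coincident endpoints `a δ = b δ = far δ` (joined by the trivial
walk — `Reachable` is reflexive even outside `Ω_δ`); the law is the Dirac mass at the constant curve at
`δ · far δ`, of norm `≥ δ⁻¹`, which leaves every compact set as `δ → 0⁺` inside ANY `(0, δ₀]`.
So the `∃ δ₀` repair of stmt-0772 works only TOGETHER with the endpoint limits. [folklore] -/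
theorem eventualTight_false_without_endpointLimits : ¬ CruxWithoutEndpointLimits := by
  intro h
  obtain ⟨δ₀, hδ₀, hT⟩ := h DobrushinDomain.unitDisc far far
    (Eventually.of_forall fun δ => SimpleGraph.Reachable.refl _)
  rw [isTightMeasureSet_iff_exists_isCompact_measure_compl_le] at hT
  obtain ⟨K, hK, hμ⟩ := hT 2⁻¹ (by simp)
  obtain ⟨R, hR0, hR⟩ := exists_bound_source_of_isCompact hK
  -- a mesh in `(0, δ₀]` with `δ⁻¹ > R`
  set δ : ℝ := min δ₀ (1 / (R + 1)) with hδ_def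
  have hδpos : 0 < δ := lt_min hδ₀ (by positivity)
  have hδle : δ ≤ δ₀ := min_le_left _ _
  have hδR : R < δ⁻¹ := by
    have h1 : δ ≤ 1 / (R + 1) := min_le_right _ _
    have h2 : R + 1 ≤ δ⁻¹ := (le_inv_comm₀ (by positivity) hδpos).2 (by simpa [one_div] using h1)
    linarith
  have hle := hμ (laws DobrushinDomain.unitDisc.carrier far far δ) ⟨δ, ⟨hδpos, hδle⟩, rfl⟩
  have hnot : CurveClass.mk (Curve.const (meshPoint δ (far δ))) ∉ K := fun hin => by
    have h1 := hR _ hin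
    simp only [CurveClass.source_mk, Curve.source_def, Curve.const_apply] at h1
    linarith [inv_le_norm_meshPoint_far hδpos]
  rw [laws_coincident _ rfl rfl, dirac_compl_eq_one hK.isClosed hnot] at hle
  exact absurd hle (by norm_num)

end EndpointLimits

/-! ## §3 Natural strengthenings — each implies the crux, each is FALSE -/

section Strengthenings

/-- S1: ALL meshes `δ ∈ (0, 1]` (no threshold) — verbatim the refuted stmt-0772 `SAWParafermion.Tight`. -/
def CruxAllMeshes : Prop :=
  ∀ (D : DobrushinDomain) (a b : ℝ → Site 2), IsEndpointApprox D a b →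
    IsTightMeasureSet (laws D.carrier a b '' Set.Ioc 0 1)

/-- S2: a threshold UNIFORM over the endpoint approximations of a domain (`∀ D ∃ δ₀ ∀ a b`). -/
def CruxUniformThreshold : Prop :=
  ∀ D : DobrushinDomain, ∃ δ₀ : ℝ, 0 < δ₀ ∧ ∀ a b : ℝ → Site 2, IsEndpointApprox D a b →
    IsTightMeasureSet (laws D.carrier a b '' Set.Ioc 0 δ₀)

/-- S3: a threshold uniform over EVERYTHING (`∃ δ₀ ∀ D a b`). -/
def CruxUniformDomains : Prop :=
  ∃ δ₀ : ℝ, 0 < δ₀ ∧ ∀ (D : DobrushinDomain) (a b : ℝ → Site 2), IsEndpointApprox D a b →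
    IsTightMeasureSet (laws D.carrier a b '' Set.Ioc 0 δ₀)

/-- S1 is syntactically stmt-0772. [folklore] -/
theorem cruxAllMeshes_iff_tight :
    CruxAllMeshes ↔ Summit.CriticalPhenomena.SAWScalingLimit.Theses.SAWParafermion.Tight :=
  Iff.rfl

/-- S1 ⇒ crux (take `δ₀ = 1`). [folklore] -/
theorem crux_of_allMeshes (h : CruxAllMeshes) : Crux := fun D a b hab => ⟨1, one_pos, h D a b hab⟩

/-- S2 ⇒ crux. [folklore] -/
theorem crux_of_uniformThreshold (h : CruxUniformThreshold) : Crux := fun D a b hab => by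
  obtain ⟨δ₀, hδ₀, hT⟩ := h D
  exact ⟨δ₀, hδ₀, hT a b hab⟩

/-- S3 ⇒ S2. [folklore] -/
theorem uniformThreshold_of_uniformDomains (h : CruxUniformDomains) : CruxUniformThreshold :=
  fun D => by
    obtain ⟨δ₀, hδ₀, hT⟩ := h
    exact ⟨δ₀, hδ₀, hT D⟩

/-- **S1 is FALSE** — this is the in-tree refutation of stmt-0772 (coincident far endpoints on
`δ ∈ (1/2, 1]`). [folklore] -/
theorem not_cruxAllMeshes : ¬ CruxAllMeshes :=
  Summit.CriticalPhenomena.SAWScalingLimit.Theorems.SAWParafermionTight_refuted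

/-- Spliced endpoints: honest unit-disc approximation below `δ₁`, far coincident sites above. -/
def spliceA (δ₁ δ : ℝ) : Site 2 := if δ ≤ δ₁ then ![⌈δ⁻¹⌉ - 1, 0] else far (δ - δ₁)

/-- Spliced endpoints: honest unit-disc approximation below `δ₁`, far coincident sites above. -/
def spliceB (δ₁ δ : ℝ) : Site 2 := if δ ≤ δ₁ then ![-(⌈δ⁻¹⌉ - 1), 0] else far (δ - δ₁)

/-- The splice is an honest endpoint approximation of `(𝔻; 1, -1)` (it agrees with
`isEndpointApprox_std` near `0⁺`). [folklore] -/
theorem isEndpointApprox_splice {δ₁ : ℝ} (hδ₁ : 0 < δ₁) :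
    IsEndpointApprox DobrushinDomain.unitDisc (spliceA δ₁) (spliceB δ₁) := by
  have hev : ∀ᶠ δ in 𝓝[>] (0 : ℝ), δ ≤ δ₁ :=
    mem_of_superset (Ioo_mem_nhdsGT hδ₁) fun δ hδ => hδ.2.le
  refine isEndpointApprox_congr isEndpointApprox_std ?_ ?_
  · exact hev.mono fun δ hδ => by simp [spliceA, hδ]
  · exact hev.mono fun δ hδ => by simp [spliceB, hδ]

/-- Above the splice point the spliced laws are NOT tight on `(0, δ₀]`: the far coincident branch
`δ ∈ (δ₁, δ₀]` carries Dirac masses at constant curves of norm `≥ δ (δ - δ₁)⁻² → ∞` as `δ ↓ δ₁`.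
[folklore] -/
theorem not_isTightMeasureSet_splice {δ₁ δ₀ : ℝ} (hδ₁ : 0 < δ₁) (h10 : δ₁ < δ₀) :
    ¬ IsTightMeasureSet
      (laws DobrushinDomain.unitDisc.carrier (spliceA δ₁) (spliceB δ₁) '' Set.Ioc 0 δ₀) := by
  intro hT
  rw [isTightMeasureSet_iff_exists_isCompact_measure_compl_le] at hT
  obtain ⟨K, hK, hμ⟩ := hT 2⁻¹ (by simp)
  obtain ⟨R, hR0, hR⟩ := exists_bound_source_of_isCompact hK
  -- the mesh `δ = δ₁ + t`, `t = min (δ₀ - δ₁) (min 1 (δ₁ / (R + 1)))`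
  set t : ℝ := min (δ₀ - δ₁) (min 1 (δ₁ / (R + 1))) with ht_def
  have htpos : 0 < t := lt_min (by linarith) (lt_min one_pos (by positivity))
  have ht0 : t ≤ δ₀ - δ₁ := min_le_left _ _
  have ht1 : t ≤ 1 := (min_le_right _ _).trans (min_le_left _ _)
  have htR : t ≤ δ₁ / (R + 1) := (min_le_right _ _).trans (min_le_right _ _)
  set δ : ℝ := δ₁ + t with hδ_def
  have hδpos : 0 < δ := by positivity
  have hδle : δ ≤ δ₀ := by linarith
  have hnot_le : ¬ δ ≤ δ₁ := by linarith
  have hsub : δ - δ₁ = t := by ring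
  -- the far point is beyond `R`
  have hfar : R < ‖meshPoint δ (far t)‖ := by
    have h1 : δ * t⁻¹ ^ 2 ≤ ‖meshPoint δ (far t)‖ := le_norm_meshPoint_far hδpos.le
    have hA : t * (R + 1) ≤ δ₁ := (le_div_iff₀ (by positivity)).1 htR
    have hδ1 : δ₁ ≤ δ := by rw [hδ_def]; linarith
    have hB : (R + 1) * t ^ 2 ≤ δ := by nlinarith
    have hC : R + 1 ≤ δ * t⁻¹ ^ 2 := by
      rw [inv_pow, ← div_eq_mul_inv, le_div_iff₀ (by positivity)]
      exact hB
    linarith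
  have hle := hμ (laws DobrushinDomain.unitDisc.carrier (spliceA δ₁) (spliceB δ₁) δ)
    ⟨δ, ⟨hδpos, hδle⟩, rfl⟩
  have hnot : CurveClass.mk (Curve.const (meshPoint δ (far t))) ∉ K := fun hin => by
    have h1 := hR _ hin
    simp only [CurveClass.source_mk, Curve.source_def, Curve.const_apply] at h1
    linarith
  rw [laws_coincident _ (w := far t) (by simp [spliceA, hnot_le, hsub]) (by simp [spliceB, hnot_le, hsub]),
    dirac_compl_eq_one hK.isClosed hnot] at hle
  exact absurd hle (by norm_num)

/-- **S2 is FALSE**: no threshold serves all endpoint approximations of the unit disc. [folklore] -/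
theorem not_cruxUniformThreshold : ¬ CruxUniformThreshold := by
  intro h
  obtain ⟨δ₀, hδ₀, hT⟩ := h DobrushinDomain.unitDisc
  exact not_isTightMeasureSet_splice (half_pos hδ₀) (half_lt_self hδ₀)
    (hT _ _ (isEndpointApprox_splice (half_pos hδ₀)))

/-- **S3 is FALSE**. [folklore] -/
theorem not_cruxUniformDomains : ¬ CruxUniformDomains :=
  fun h => not_cruxUniformThreshold (uniformThreshold_of_uniformDomains h)

end Strengthenings

/-! ## §4 Verdict of generation 1 — why the crux resists -/

/-- **VERDICT (cdisprove generation 1): NO KILL; the crux is almost certainly TRUE and equivalent to an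
open problem.** Attack log:
1. Junk regimes (§1): unreachable endpoints ⇒ zero law; `Z = ∞` impossible (bounded `Ω`, `δ > 0`);
   every pushed law has mass `≤ 1` — junk only HELPS tightness.
2. Coincident far endpoints (the 0772 mechanism): excluded inside `(0, δ₀]` by the endpoint limits,
   which are therefore load-bearing (§2, `eventualTight_false_without_endpointLimits`); `reachable`
   is not.
3. Quantifier strengthenings `∀ D ∃ δ₀ ∀ (a,b)` and `∃ δ₀ ∀ D (a,b)`: FALSE (§3); all meshes: = 0772.
4. Dropping the Jordan loop: FALSE (§5, dyadic snake) — boundary regularity is load-bearing; in a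
   JORDAN domain the number of FORCED traversals of a fixed shell is bounded (local connectivity), so
   deterministic forcing cannot refute the crux; slits / zero-width teeth are invisible (`meshGraph`
   uses `closure Ω`), cusps force straight runs (no oscillation), base-comb shortcuts get resolved as
   `δ → 0`, two corridors contradict simple connectivity.
5. Positive meshes are free (window compactness `exists_isCompact_forall_curve_mem_zd`, landed): the
   content is `δ → 0⁺` only; the twins stmt-1881/4922 are equivalent (HexTight/Disproof §5).
6. NECESSITY: `SAWScalingLimit → EventualTight` (refuter cdisprove-0783, SubseqIdentification/Disproof
   §6; negative form re-hosted for landing as `Theorems/EventualTight/Negative/TightnessNecessary.lean`):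
   a kill of the crux kills the summit conjunct as typed. EQUIVALENCE with the sibling crux
   `ShellCrossingBound` (landed `Negative/OfEventualTight` + support `TightOfShellCrossing`).
7. Honest regime: an honest counterexample needs a Jordan domain in which the critical `ℤ²` SAW makes,
   with probability `≥ η`, unboundedly many `ε`-oscillations along `δ → 0` — a quantitative
   NON-regularity theorem (failure of Aizenman–Burchard (H1) / Kemppainen–Smirnov G2 at `x_c`)
   contradicting SLE(8/3); no mechanism is known and no rigorous tool controls the critical two-point
   SAW measure in the bulk (only sub-ballisticity, Duminil-Copin–Hammond 2013, is unconditional;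
   Kemppainen–Smirnov 2017 §4 omits SAW). The crux RESISTS. [folklore] -/
theorem resists : True := trivial

/-! ## §5 Boundary regularity is load-bearing: the dyadic snake domain

Over bounded open CONNECTED sets with two marked FRONTIER points (all the fields of `DobrushinDomain`
except the Jordan boundary loop) the statement of the crux is FALSE (`eventualTight_false_without_jordan`).
The witness `Snake.Ω = ⋃ₖ col k ∪ conn k` (`col k = (5/8·2⁻ᵏ, 2⁻ᵏ) × (0,1)`,
`conn k = (5/16·2⁻ᵏ, 2⁻ᵏ) × ((0,¼) | (¾,1))` by parity of `k`) has a frontier containing `{0} × [0,1]`,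
not locally connected there. Self-similar columns make the largest-component bookkeeping of `Ω_δ`
tractable (everything of abscissa `> 16 δ` is ONE component, identified by a counting injection of
the tail into `col 0`), and the walls `re = 9/16·2⁻ᵏ` pin the ordinate of `closure Ω` to the closed
windows, so the intermediate value theorem forces `K δ / 2 → ∞` traversals of the FIXED shell
`D((1/2, 0); 3/5, 7/10)` on EVERY SAW from `a δ` (deep in the snake, `→ 0`) to `b δ ∈ col 0`
(`→ 5/8`). -/

namespace Snake

open Complex

/-! ### The dyadic snake: geometry -/

/-- Dyadic scales `r k = 2^{-k}`. -/
def r (k : ℕ) : ℝ := (1 / 2 : ℝ) ^ k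

/-- Left edge of the `k`-th column, `l k = (5/8) 2^{-k}`. -/
def l (k : ℕ) : ℝ := 5 / 8 * r k

/-- Wall midpoints `m k = (9/16) 2^{-k}` (strictly between `r (k+1) = r k / 2` and `l k`). -/
def m (k : ℕ) : ℝ := 9 / 16 * r k

/-- The window of the `k`-th connector: at the bottom for even `k`, at the top for odd `k`. -/
def win (k : ℕ) : Set ℝ := if Even k then Ioo 0 (1 / 4) else Ioo (3 / 4) 1

/-- Closed windows. -/
def cwin (k : ℕ) : Set ℝ := if Even k then Icc 0 (1 / 4) else Icc (3 / 4) 1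

/-- The `k`-th column `(l k, r k) × (0, 1)`. -/
def col (k : ℕ) : Set ℂ := Ioo (l k) (r k) ×ℂ Ioo 0 1

/-- The `k`-th connector `(l (k+1), r k) × win k`, bridging the wall between columns `k+1` and `k`. -/
def conn (k : ℕ) : Set ℂ := Ioo (l (k + 1)) (r k) ×ℂ win k

/-- **The snake domain**: columns of width `(3/8) 2^{-k}` accumulating at the imaginary axis, joined
alternately at the bottom and at the top. Open, bounded, connected; its frontier contains the
segment `{0} × [0, 1]` and is NOT locally connected there (not a Jordan domain). -/
def Ω : Set ℂ := ⋃ k : ℕ, (col k ∪ conn k)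

theorem r_pos (k : ℕ) : 0 < r k := by unfold r; positivity

theorem r_zero : r 0 = 1 := by simp [r]

theorem r_succ (k : ℕ) : r (k + 1) = r k / 2 := by unfold r; rw [pow_succ]; ring

theorem r_le_one (k : ℕ) : r k ≤ 1 := pow_le_one₀ (by norm_num) (by norm_num)

theorem r_antitone : Antitone r := fun _ _ h => pow_le_pow_of_le_one (by norm_num) (by norm_num) h

theorem r_lt_of_lt {j k : ℕ} (h : j < k) : r k < r j :=
  pow_lt_pow_right_of_lt_one₀ (by norm_num) (by norm_num) h

theorem l_pos (k : ℕ) : 0 < l k := by unfold l; have := r_pos k; positivity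

theorem l_lt_r (k : ℕ) : l k < r k := by unfold l; have := r_pos k; linarith

theorem l_antitone : Antitone l := fun _ _ h => by
  unfold l; exact mul_le_mul_of_nonneg_left (r_antitone h) (by norm_num)

theorem l_succ_lt_r_succ (k : ℕ) : l (k + 1) < r (k + 1) := l_lt_r _

theorem r_succ_lt_m (k : ℕ) : r (k + 1) < m k := by rw [r_succ]; unfold m; have := r_pos k; linarith

theorem m_lt_l (k : ℕ) : m k < l k := by unfold m l; have := r_pos k; linarith

theorem m_antitone_strict {j k : ℕ} (h : j < k) : m k < m j := by
  unfold m; have := r_lt_of_lt h; linarith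

theorem m_le_one (k : ℕ) : m k ≤ 1 := by unfold m; have := r_le_one k; have := r_pos k; linarith

theorem m_nonneg (k : ℕ) : 0 ≤ m k := by unfold m; have := r_pos k; positivity

theorem win_subset (k : ℕ) : win k ⊆ Ioo 0 1 := by
  unfold win; split_ifs
  · exact Ioo_subset_Ioo le_rfl (by norm_num)
  · exact Ioo_subset_Ioo (by norm_num) le_rfl

theorem win_subset_cwin (k : ℕ) : win k ⊆ cwin k := by
  unfold win cwin; split_ifs <;> exact Ioo_subset_Icc_self

theorem isClosed_cwin (k : ℕ) : IsClosed (cwin k) := by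
  unfold cwin; split_ifs <;> exact isClosed_Icc

theorem isOpen_win (k : ℕ) : IsOpen (win k) := by
  unfold win; split_ifs <;> exact isOpen_Ioo

theorem convex_win (k : ℕ) : Convex ℝ (win k) := by
  unfold win; split_ifs <;> exact convex_Ioo _ _

theorem col_subset_Ω (k : ℕ) : col k ⊆ Ω := fun _ hz => mem_iUnion.2 ⟨k, Or.inl hz⟩

theorem conn_subset_Ω (k : ℕ) : conn k ⊆ Ω := fun _ hz => mem_iUnion.2 ⟨k, Or.inr hz⟩

/-- A box with convex sides is convex. [folklore] -/
theorem convex_reProdIm {s t : Set ℝ} (hs : Convex ℝ s) (ht : Convex ℝ t) : Convex ℝ (s ×ℂ t) := by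
  have := convex_convexHull ℝ (s ×ℂ t)
  rwa [Complex.convexHull_reProdIm, hs.convexHull_eq, ht.convexHull_eq] at this

theorem convex_col (k : ℕ) : Convex ℝ (col k) := convex_reProdIm (convex_Ioo _ _) (convex_Ioo _ _)

theorem convex_conn (k : ℕ) : Convex ℝ (conn k) := convex_reProdIm (convex_Ioo _ _) (convex_win k)

theorem isOpen_Ω : IsOpen Ω :=
  isOpen_iUnion fun k => (isOpen_Ioo.reProdIm isOpen_Ioo).union (isOpen_Ioo.reProdIm (isOpen_win k))

/-- Every point of the snake has `0 < re ≤ 1` and `0 < im < 1`. -/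
theorem re_im_of_mem {z : ℂ} (hz : z ∈ Ω) : 0 < z.re ∧ z.re < 1 ∧ 0 < z.im ∧ z.im < 1 := by
  obtain ⟨k, hk⟩ := mem_iUnion.1 hz
  rcases hk with ⟨hre, him⟩ | ⟨hre, him⟩
  · exact ⟨(l_pos k).trans hre.1, hre.2.trans_le (r_le_one k), him.1, him.2⟩
  · have him' := win_subset k him
    exact ⟨(l_pos _).trans hre.1, hre.2.trans_le (r_le_one k), him'.1, him'.2⟩

theorem isBounded_Ω : Bornology.IsBounded Ω := by
  refine (isBounded_iff_subset_closedBall 0).2 ⟨2, fun z hz => ?_⟩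
  obtain ⟨h1, h2, h3, h4⟩ := re_im_of_mem hz
  rw [mem_closedBall, dist_zero_right]
  refine (norm_le_abs_re_add_abs_im z).trans ?_
  rw [abs_of_pos h1, abs_of_pos h3]
  linarith

/-- A point in `col k ∩ conn k`. -/
def pcc (k : ℕ) : ℂ := ⟨3 / 4 * r k, if Even k then 1 / 8 else 7 / 8⟩

theorem pcc_mem_col (k : ℕ) : pcc k ∈ col k := by
  have := r_pos k; have := r_le_one k
  refine ⟨⟨?_, ?_⟩, ?_⟩
  · show l k < 3 / 4 * r k; unfold l; linarith
  · show 3 / 4 * r k < r k; linarith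
  · show (if Even k then (1:ℝ) / 8 else 7 / 8) ∈ Ioo 0 1
    split_ifs <;> constructor <;> norm_num

theorem pcc_mem_conn (k : ℕ) : pcc k ∈ conn k := by
  have := r_pos k
  refine ⟨⟨?_, ?_⟩, ?_⟩
  · show l (k + 1) < 3 / 4 * r k; unfold l; rw [r_succ]; linarith
  · show 3 / 4 * r k < r k; linarith
  · show (if Even k then (1:ℝ) / 8 else 7 / 8) ∈ win k
    unfold win; split_ifs <;> constructor <;> norm_num

/-- A point in `conn k ∩ col (k+1)`. -/
def pcn (k : ℕ) : ℂ := ⟨3 / 4 * r (k + 1), if Even k then 1 / 8 else 7 / 8⟩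

theorem pcn_mem_conn (k : ℕ) : pcn k ∈ conn k := by
  have := r_pos k
  refine ⟨⟨?_, ?_⟩, ?_⟩
  · show l (k + 1) < 3 / 4 * r (k + 1); unfold l; linarith [r_pos (k + 1)]
  · show 3 / 4 * r (k + 1) < r k; rw [r_succ]; linarith
  · show (if Even k then (1:ℝ) / 8 else 7 / 8) ∈ win k
    unfold win; split_ifs <;> constructor <;> norm_num

theorem pcn_mem_col_succ (k : ℕ) : pcn k ∈ col (k + 1) := by
  have := r_pos (k + 1); have := r_le_one (k + 1)
  refine ⟨⟨?_, ?_⟩, ?_⟩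
  · show l (k + 1) < 3 / 4 * r (k + 1); unfold l; linarith
  · show 3 / 4 * r (k + 1) < r (k + 1); linarith
  · show (if Even k then (1:ℝ) / 8 else 7 / 8) ∈ Ioo 0 1
    split_ifs <;> constructor <;> norm_num

theorem isConnected_Ω : IsConnected Ω := by
  refine IsConnected.iUnion_of_chain (fun k => ?_) (fun k => ?_)
  · exact IsConnected.union ⟨pcc k, pcc_mem_col k, pcc_mem_conn k⟩
      ((convex_col k).isConnected ⟨pcc k, pcc_mem_col k⟩)
      ((convex_conn k).isConnected ⟨pcc k, pcc_mem_conn k⟩)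
  · refine ⟨pcn k, Or.inr (pcn_mem_conn k), ?_⟩
    rw [Nat.succ_eq_succ]
    exact Or.inl (pcn_mem_col_succ k)

/-- A closed superset of the snake pinning the ordinate on the wall strips. -/
def S : Set ℂ :=
  ({z : ℂ | 0 ≤ z.re} ∩ {z | z.re ≤ 1} ∩ {z | 0 ≤ z.im} ∩ {z | z.im ≤ 1}) ∩
    ⋂ k : ℕ, ({z : ℂ | z.re ≤ r (k + 1)} ∪ {z | l k ≤ z.re} ∪ {z | z.im ∈ cwin k})

theorem isClosed_S : IsClosed S := by
  refine IsClosed.inter ?_ (isClosed_iInter fun k => ?_)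
  · exact (((isClosed_le continuous_const continuous_re).inter
      (isClosed_le continuous_re continuous_const)).inter
      (isClosed_le continuous_const continuous_im)).inter
      (isClosed_le continuous_im continuous_const)
  · exact ((isClosed_le continuous_re continuous_const).union
      (isClosed_le continuous_const continuous_re)).union
      ((isClosed_cwin k).preimage continuous_im)

theorem Ω_subset_S : Ω ⊆ S := by
  intro z hz
  obtain ⟨h1, h2, h3, h4⟩ := re_im_of_mem hz
  refine ⟨⟨⟨⟨h1.le, h2.le⟩, h3.le⟩, h4.le⟩, mem_iInter.2 fun k => ?_⟩
  obtain ⟨j, hj⟩ := mem_iUnion.1 hz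
  rcases hj with ⟨hre, -⟩ | ⟨hre, him⟩
  · -- `z ∈ col j`
    rcases le_or_gt (k + 1) j with hkj | hkj
    · exact Or.inl (Or.inl (hre.2.le.trans (r_antitone hkj)))
    · exact Or.inl (Or.inr ((l_antitone (Nat.lt_succ_iff.1 hkj)).trans hre.1.le))
  · -- `z ∈ conn j`
    rcases lt_trichotomy j k with hjk | rfl | hjk
    · exact Or.inl (Or.inr ((l_antitone (Nat.succ_le_of_lt hjk)).trans hre.1.le))
    · exact Or.inr (win_subset_cwin j him)
    · exact Or.inl (Or.inl (hre.2.le.trans (r_antitone (Nat.succ_le_of_lt hjk))))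

theorem closure_Ω_subset_S : closure Ω ⊆ S := closure_minimal Ω_subset_S isClosed_S

/-- **On the `k`-th wall the ordinate of `closure Ω` is pinned to the closed window.** -/
theorem im_mem_cwin_of_re_eq_m {z : ℂ} (hz : z ∈ closure Ω) {k : ℕ} (hre : z.re = m k) :
    z.im ∈ cwin k := by
  have h := (mem_iInter.1 (closure_Ω_subset_S hz).2 k)
  rcases h with (h | h) | h
  · exact absurd (hre ▸ h : m k ≤ r (k + 1)) (not_le.2 (r_succ_lt_m k))
  · exact absurd (hre ▸ h : l k ≤ m k) (not_le.2 (m_lt_l k))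
  · exact h

theorem re_im_of_mem_closure {z : ℂ} (hz : z ∈ closure Ω) :
    0 ≤ z.re ∧ z.re ≤ 1 ∧ 0 ≤ z.im ∧ z.im ≤ 1 := by
  obtain ⟨⟨⟨⟨h1, h2⟩, h3⟩, h4⟩, -⟩ := closure_Ω_subset_S hz
  exact ⟨h1, h2, h3, h4⟩

/-! ### The marked frontier points `p = 0` (at the accumulation) and `q = 5/8` -/

theorem zero_not_mem : (0 : ℂ) ∉ Ω := fun h => by simpa using (re_im_of_mem h).1

theorem zero_mem_closure : (0 : ℂ) ∈ closure Ω := by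
  rw [Metric.mem_closure_iff]
  intro ε hε
  obtain ⟨k, hk⟩ := exists_pow_lt_of_lt_one hε (by norm_num : (1 / 2 : ℝ) < 1)
  refine ⟨⟨3 / 4 * r k, 1 / 8 * r k⟩, col_subset_Ω k ⟨⟨?_, ?_⟩, ?_, ?_⟩, ?_⟩
  · show l k < 3 / 4 * r k; unfold l; linarith [r_pos k]
  · show 3 / 4 * r k < r k; linarith [r_pos k]
  · show 0 < 1 / 8 * r k; linarith [r_pos k]
  · show 1 / 8 * r k < 1; linarith [r_le_one k]
  · rw [dist_comm, dist_zero_right]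
    refine (norm_le_abs_re_add_abs_im _).trans_lt ?_
    have hr := r_pos k
    simp only [abs_of_pos (by positivity : (0:ℝ) < 3 / 4 * r k),
      abs_of_pos (by positivity : (0:ℝ) < 1 / 8 * r k)]
    have : r k < ε := hk
    linarith

theorem zero_mem_frontier : (0 : ℂ) ∈ frontier Ω := by
  rw [frontier, isOpen_Ω.interior_eq]
  exact ⟨zero_mem_closure, zero_not_mem⟩

theorem q_not_mem : ((5 / 8 : ℝ) : ℂ) ∉ Ω := fun h => by simpa using (re_im_of_mem h).2.2.1

theorem q_mem_closure : ((5 / 8 : ℝ) : ℂ) ∈ closure Ω := by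
  rw [Metric.mem_closure_iff]
  intro ε hε
  set t : ℝ := min (ε / 4) (1 / 4) with ht
  have ht0 : 0 < t := lt_min (by positivity) (by norm_num)
  have htε : t ≤ ε / 4 := min_le_left _ _
  have ht4 : t ≤ 1 / 4 := min_le_right _ _
  refine ⟨⟨5 / 8 + t, t⟩, col_subset_Ω 0 ⟨⟨?_, ?_⟩, ?_, ?_⟩, ?_⟩
  · show l 0 < 5 / 8 + t; unfold l; rw [r_zero]; linarith
  · show 5 / 8 + t < r 0; rw [r_zero]; linarith
  · exact ht0
  · show t < 1; linarith
  · rw [Complex.dist_eq]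
    refine (norm_le_abs_re_add_abs_im _).trans_lt ?_
    simp only [sub_re, sub_im, ofReal_re, ofReal_im]
    rw [show (5 : ℝ) / 8 - (5 / 8 + t) = -t by ring, show (0 : ℝ) - t = -t by ring, abs_neg,
      abs_of_pos ht0]
    linarith

theorem q_mem_frontier : ((5 / 8 : ℝ) : ℂ) ∈ frontier Ω := by
  rw [frontier, isOpen_Ω.interior_eq]
  exact ⟨q_mem_closure, q_not_mem⟩

/-! ### Lattice bookkeeping at mesh `δ` -/

theorem vec_mem_iff {δ : ℝ} {i j : ℤ} :
    (![i, j] : Site 2) ∈ meshVertices Ω δ ↔ (⟨δ * i, δ * j⟩ : ℂ) ∈ Ω := by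
  rw [mem_meshVertices_iff, meshPoint_vec]

/-- Reachability of two lattice sites inside the mesh vertex graph of the snake. -/
def Reach (δ : ℝ) (u v : Site 2) : Prop :=
  ∃ (hu : u ∈ meshVertices Ω δ) (hv : v ∈ meshVertices Ω δ),
    (meshVertexGraph Ω δ).Reachable ⟨u, hu⟩ ⟨v, hv⟩

theorem Reach.fst {δ : ℝ} {u v : Site 2} (h : Reach δ u v) : u ∈ meshVertices Ω δ := h.1

theorem Reach.snd {δ : ℝ} {u v : Site 2} (h : Reach δ u v) : v ∈ meshVertices Ω δ := h.2.1

theorem Reach.rfl' {δ : ℝ} {u : Site 2} (hu : u ∈ meshVertices Ω δ) : Reach δ u u :=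
  ⟨hu, hu, SimpleGraph.Reachable.refl _⟩

theorem Reach.symm {δ : ℝ} {u v : Site 2} (h : Reach δ u v) : Reach δ v u := by
  obtain ⟨hu, hv, h⟩ := h; exact ⟨hv, hu, h.symm⟩

theorem Reach.trans {δ : ℝ} {u v w : Site 2} (h₁ : Reach δ u v) (h₂ : Reach δ v w) :
    Reach δ u w := by
  obtain ⟨hu, hv, h₁⟩ := h₁; obtain ⟨hv', hw, h₂⟩ := h₂; exact ⟨hu, hw, h₁.trans h₂⟩

/-- Two `ℤ²`-neighbours whose mesh points lie in a common convex part of the snake are joined. -/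
theorem reach_of_adj_of_convex {δ : ℝ} {P : Set ℂ} (hP : Convex ℝ P) (hPΩ : P ⊆ Ω) {u v : Site 2}
    (huv : (zdGraph 2).Adj u v) (hu : meshPoint δ u ∈ P) (hv : meshPoint δ v ∈ P) : Reach δ u v := by
  have hu' : u ∈ meshVertices Ω δ := hPΩ hu
  have hv' : v ∈ meshVertices Ω δ := hPΩ hv
  refine ⟨hu', hv', SimpleGraph.Adj.reachable ?_⟩
  simp only [SimpleGraph.comap_adj, Function.Embedding.subtype_apply]
  exact meshGraph_adj_iff.2 ⟨huv, ((hP.segment_subset hu hv).trans hPΩ).trans subset_closure⟩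

/-- Horizontal run inside a convex box of the snake: `(i, j) ⇝ (i + n, j)`. -/
theorem reach_row {δ : ℝ} (hδ : 0 < δ) {s t : Set ℝ} [s.OrdConnected] (hst : Convex ℝ (s ×ℂ t))
    (hΩ : s ×ℂ t ⊆ Ω) {i j : ℤ} {n : ℕ} (hi : δ * i ∈ s) (hin : δ * (i + n) ∈ s) (hj : δ * j ∈ t) :
    Reach δ ![i, j] ![i + n, j] := by
  have hmem : ∀ m : ℕ, m ≤ n → (⟨δ * (i + m), δ * j⟩ : ℂ) ∈ s ×ℂ t := fun m hm =>
    ⟨Set.OrdConnected.out ‹_› hi hin ⟨by push_cast; nlinarith, by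
      have : (m : ℝ) ≤ n := by exact_mod_cast hm
      nlinarith⟩, hj⟩
  have key : ∀ m : ℕ, m ≤ n → Reach δ ![i, j] ![i + m, j] := by
    intro m
    induction m with
    | zero =>
      intro _
      have h0 := hmem 0 (Nat.zero_le _)
      simp only [Nat.cast_zero, add_zero] at h0 ⊢
      exact Reach.rfl' (vec_mem_iff.2 (hΩ h0))
    | succ m ih =>
      intro hm
      refine (ih (Nat.le_of_succ_le hm)).trans (reach_of_adj_of_convex hst hΩ ?_ ?_ ?_)
      · rw [zdGraph_adj_iff]
        refine ⟨0, Or.inl ?_⟩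
        rw [vec_add_single_zero]; push_cast; ring_nf
      · rw [meshPoint_vec]; exact_mod_cast hmem m (Nat.le_of_succ_le hm)
      · rw [meshPoint_vec]; exact_mod_cast hmem (m + 1) hm
  exact key n le_rfl

/-- Vertical run inside a convex box of the snake: `(i, j) ⇝ (i, j + n)`. -/
theorem reach_colrun {δ : ℝ} (hδ : 0 < δ) {s t : Set ℝ} [t.OrdConnected] (hst : Convex ℝ (s ×ℂ t))
    (hΩ : s ×ℂ t ⊆ Ω) {i j : ℤ} {n : ℕ} (hi : δ * i ∈ s) (hj : δ * j ∈ t) (hjn : δ * (j + n) ∈ t) :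
    Reach δ ![i, j] ![i, j + n] := by
  have hmem : ∀ m : ℕ, m ≤ n → (⟨δ * i, δ * (j + m)⟩ : ℂ) ∈ s ×ℂ t := fun m hm =>
    ⟨hi, Set.OrdConnected.out ‹_› hj hjn ⟨by push_cast; nlinarith, by
      have : (m : ℝ) ≤ n := by exact_mod_cast hm
      nlinarith⟩⟩
  have key : ∀ m : ℕ, m ≤ n → Reach δ ![i, j] ![i, j + m] := by
    intro m
    induction m with
    | zero =>
      intro _
      have h0 := hmem 0 (Nat.zero_le _)
      simp only [Nat.cast_zero, add_zero] at h0 ⊢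
      exact Reach.rfl' (vec_mem_iff.2 (hΩ h0))
    | succ m ih =>
      intro hm
      refine (ih (Nat.le_of_succ_le hm)).trans (reach_of_adj_of_convex hst hΩ ?_ ?_ ?_)
      · rw [zdGraph_adj_iff]
        refine ⟨1, Or.inl ?_⟩
        rw [vec_add_single_one]; push_cast; ring_nf
      · rw [meshPoint_vec]; exact_mod_cast hmem m (Nat.le_of_succ_le hm)
      · rw [meshPoint_vec]; exact_mod_cast hmem (m + 1) hm
  exact key n le_rfl

/-- Horizontal run, either direction. -/
theorem reach_row' {δ : ℝ} (hδ : 0 < δ) {s t : Set ℝ} [s.OrdConnected] (hst : Convex ℝ (s ×ℂ t))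
    (hΩ : s ×ℂ t ⊆ Ω) {i i' j : ℤ} (hi : δ * i ∈ s) (hi' : δ * i' ∈ s) (hj : δ * j ∈ t) :
    Reach δ ![i, j] ![i', j] := by
  rcases le_total i i' with h | h
  · obtain ⟨n, rfl⟩ := Int.le.dest h
    exact reach_row hδ hst hΩ hi (by exact_mod_cast hi') hj
  · obtain ⟨n, rfl⟩ := Int.le.dest h
    exact (reach_row hδ hst hΩ hi' (by exact_mod_cast hi) hj).symm

/-- Vertical run, either direction. -/
theorem reach_colrun' {δ : ℝ} (hδ : 0 < δ) {s t : Set ℝ} [t.OrdConnected] (hst : Convex ℝ (s ×ℂ t))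
    (hΩ : s ×ℂ t ⊆ Ω) {i j j' : ℤ} (hi : δ * i ∈ s) (hj : δ * j ∈ t) (hj' : δ * j' ∈ t) :
    Reach δ ![i, j] ![i, j'] := by
  rcases le_total j j' with h | h
  · obtain ⟨n, rfl⟩ := Int.le.dest h
    exact reach_colrun hδ hst hΩ hi hj (by exact_mod_cast hj')
  · obtain ⟨n, rfl⟩ := Int.le.dest h
    exact (reach_colrun hδ hst hΩ hi hj' (by exact_mod_cast hj)).symm

/-! ### Resolved levels and the descent to the base point -/

/-- The first lattice abscissa right of `x`: `⌊x/δ⌋ + 1`. -/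
def nxt (δ x : ℝ) : ℤ := ⌊x / δ⌋ + 1

theorem nxt_bounds {δ : ℝ} (hδ : 0 < δ) (x : ℝ) : x < δ * nxt δ x ∧ δ * nxt δ x ≤ x + δ := by
  unfold nxt
  have h1 := Int.floor_le (x / δ)
  have h2 := Int.lt_floor_add_one (x / δ)
  push_cast
  constructor
  · have := mul_lt_mul_of_pos_left h2 hδ
    rwa [mul_div_cancel₀ _ hδ.ne'] at this
  · have := mul_le_mul_of_nonneg_left h1 hδ.le
    rw [mul_div_cancel₀ _ hδ.ne'] at this
    linarith

/-- The lattice row of the window of level `k`: row `1` at the bottom, `⌊3/(4δ)⌋ + 1` at the top. -/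
def jw (δ : ℝ) (k : ℕ) : ℤ := if Even k then 1 else nxt δ (3 / 4)

theorem jw_mem_win {δ : ℝ} (hδ : 0 < δ) (hδ4 : δ < 1 / 4) (k : ℕ) : δ * (jw δ k) ∈ win k := by
  unfold jw win
  split_ifs with h
  · push_cast; constructor <;> linarith
  · obtain ⟨h1, h2⟩ := nxt_bounds hδ (3 / 4)
    exact ⟨h1, by linarith⟩

theorem jw_mem_Ioo {δ : ℝ} (hδ : 0 < δ) (hδ4 : δ < 1 / 4) (k : ℕ) : δ * (jw δ k) ∈ Ioo (0:ℝ) 1 :=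
  win_subset k (jw_mem_win hδ hδ4 k)

theorem one_mem_Ioo {δ : ℝ} (hδ : 0 < δ) (hδ4 : δ < 1 / 4) : δ * ((1 : ℤ) : ℝ) ∈ Ioo (0:ℝ) 1 := by
  push_cast; constructor <;> linarith

/-- The base column abscissa `I δ + 1 = ⌊(5/8)/δ⌋ + 1`, the first lattice abscissa in `col 0`. -/
def ib (δ : ℝ) : ℤ := nxt δ (5 / 8)

/-- The base point `v₀ δ = (ib δ, 1) ∈ col 0`. -/
def v₀ (δ : ℝ) : Site 2 := ![ib δ, 1]

theorem ib_mem {δ : ℝ} (hδ : 0 < δ) (hδs : δ < 3 / 8) : δ * (ib δ) ∈ Ioo (l 0) (r 0) := by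
  obtain ⟨h1, h2⟩ := nxt_bounds hδ (5 / 8)
  unfold ib l; rw [r_zero]
  exact ⟨by linarith, by linarith⟩

theorem meshPoint_v₀_mem {δ : ℝ} (hδ : 0 < δ) (hδs : δ < 1 / 4) : meshPoint δ (v₀ δ) ∈ col 0 := by
  rw [v₀, meshPoint_vec]
  exact ⟨ib_mem hδ (by linarith), one_mem_Ioo hδ hδs⟩

/-- From any lattice point of a resolved column `col k` (`16 δ < r k`) to the base point. -/
theorem reach_v₀_of_col {δ : ℝ} (hδ : 0 < δ) (hδs : δ < 1 / 64) :
    ∀ (k : ℕ), 16 * δ < r k → ∀ (i j : ℤ), (⟨δ * i, δ * j⟩ : ℂ) ∈ col k → Reach δ ![i, j] (v₀ δ) := by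
  intro k
  induction k with
  | zero =>
    intro _ i j hij
    obtain ⟨hi, hj⟩ := hij
    have h1 : Reach δ ![i, j] ![i, 1] :=
      reach_colrun' hδ (convex_col 0) (col_subset_Ω 0) hi hj (one_mem_Ioo hδ (by linarith))
    refine h1.trans ?_
    exact reach_row' hδ (convex_col 0) (col_subset_Ω 0) hi (ib_mem hδ (by linarith))
      (one_mem_Ioo hδ (by linarith))
  | succ k ih =>
    intro hres i j hij
    obtain ⟨hi, hj⟩ := hij
    have hresk : 16 * δ < r k := hres.trans (r_lt_of_lt (Nat.lt_succ_self k))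
    have hδ4 : δ < 1 / 4 := by linarith
    -- up/down the column to the window row of level `k`
    have h1 : Reach δ ![i, j] ![i, jw δ k] :=
      reach_colrun' hδ (convex_col (k + 1)) (col_subset_Ω (k + 1)) hi hj (jw_mem_Ioo hδ hδ4 k)
    -- along the connector `conn k` to the first abscissa of `col k`
    obtain ⟨hn1, hn2⟩ := nxt_bounds hδ (l k)
    have hwidth : l k + δ < r k := by unfold l; linarith
    have hi2 : δ * (nxt δ (l k)) ∈ Ioo (l (k + 1)) (r k) :=
      ⟨(l_antitone (Nat.le_succ k)).trans_lt hn1, by linarith⟩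
    have hi1 : δ * i ∈ Ioo (l (k + 1)) (r k) := ⟨hi.1, hi.2.trans (r_lt_of_lt (Nat.lt_succ_self k))⟩
    have h2 : Reach δ ![i, jw δ k] ![nxt δ (l k), jw δ k] :=
      reach_row' hδ (convex_conn k) (conn_subset_Ω k) hi1 hi2 (jw_mem_win hδ hδ4 k)
    -- and now we are in `col k`
    have h3 : (⟨δ * (nxt δ (l k)), δ * (jw δ k)⟩ : ℂ) ∈ col k :=
      ⟨⟨hn1, by linarith⟩, jw_mem_Ioo hδ hδ4 k⟩
    exact (h1.trans h2).trans (ih hresk _ _ h3)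

/-- From any lattice point of a resolved connector `conn k` (`16 δ < r k`) to the base point. -/
theorem reach_v₀_of_conn {δ : ℝ} (hδ : 0 < δ) (hδs : δ < 1 / 64) {k : ℕ} (hres : 16 * δ < r k)
    {i j : ℤ} (hij : (⟨δ * i, δ * j⟩ : ℂ) ∈ conn k) : Reach δ ![i, j] (v₀ δ) := by
  obtain ⟨hi, hj⟩ := hij
  obtain ⟨hn1, hn2⟩ := nxt_bounds hδ (l k)
  have hwidth : l k + δ < r k := by unfold l; linarith
  have hi2 : δ * (nxt δ (l k)) ∈ Ioo (l (k + 1)) (r k) :=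
    ⟨(l_antitone (Nat.le_succ k)).trans_lt hn1, by linarith⟩
  have h1 : Reach δ ![i, j] ![nxt δ (l k), j] :=
    reach_row' hδ (convex_conn k) (conn_subset_Ω k) hi hi2 hj
  have h2 : (⟨δ * (nxt δ (l k)), δ * j⟩ : ℂ) ∈ col k := ⟨⟨hn1, by linarith⟩, win_subset k hj⟩
  exact h1.trans (reach_v₀_of_col hδ hδs k hres _ _ h2)

/-! ### Room versus tail: the room holds the unique largest component -/

/-- Room: mesh vertices of abscissa index `> 16`. -/
def RS (δ : ℝ) : Set (Site 2) := {v | v ∈ meshVertices Ω δ ∧ 16 < v 0}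

/-- Tail: mesh vertices of abscissa index `≤ 16`. -/
def TS (δ : ℝ) : Set (Site 2) := {v | v ∈ meshVertices Ω δ ∧ v 0 ≤ 16}

/-- Every room vertex reaches the base point. -/
theorem reach_v₀_of_mem_RS {δ : ℝ} (hδ : 0 < δ) (hδs : δ < 1 / 64) {v : Site 2} (hv : v ∈ RS δ) :
    Reach δ v (v₀ δ) := by
  obtain ⟨hvm, hv16⟩ := hv
  rw [eq_vec v] at hvm ⊢
  have hz := vec_mem_iff.1 hvm
  obtain ⟨k, hk⟩ := mem_iUnion.1 hz
  have h17 : (17 : ℝ) ≤ v 0 := by exact_mod_cast hv16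
  have hres_of : δ * v 0 < r k → 16 * δ < r k := fun h => by nlinarith
  rcases hk with hk | hk
  · exact reach_v₀_of_col hδ hδs k (hres_of hk.1.2) _ _ hk
  · exact reach_v₀_of_conn hδ hδs (hres_of hk.1.2) hk

theorem v₀_mem_RS {δ : ℝ} (hδ : 0 < δ) (hδs : δ < 1 / 64) : v₀ δ ∈ RS δ := by
  refine ⟨col_subset_Ω 0 (meshPoint_v₀_mem hδ (by linarith)), ?_⟩
  show (16 : ℤ) < ib δ
  obtain ⟨h1, -⟩ := nxt_bounds hδ (5 / 8)
  have : (16 : ℝ) < nxt δ (5 / 8) := by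
    by_contra h
    push Not at h
    nlinarith
  exact_mod_cast this

/-- The tail-to-room injection: shift by `ib δ` columns into `col 0`. -/
def fsh (δ : ℝ) (v : Site 2) : Site 2 := ![v 0 + ib δ, v 1]

theorem fsh_injective (δ : ℝ) : Function.Injective (fsh δ) := by
  intro v w h
  have h0 := congrFun h 0
  have h1 := congrFun h 1
  simp only [fsh, Matrix.cons_val_zero, Matrix.cons_val_one] at h0 h1
  rw [eq_vec v, eq_vec w, h1, show v 0 = w 0 by linarith]

/-- Abscissa indices of mesh vertices are positive. -/
theorem one_le_of_mem {δ : ℝ} (hδ : 0 < δ) {v : Site 2} (hv : v ∈ meshVertices Ω δ) : 1 ≤ v 0 := by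
  rw [eq_vec v] at hv
  have h := (re_im_of_mem (vec_mem_iff.1 hv)).1
  simp only at h
  have : (0 : ℝ) < v 0 := by nlinarith
  exact_mod_cast this

theorem im_mem_of_mem {δ : ℝ} {v : Site 2} (hv : v ∈ meshVertices Ω δ) : δ * v 1 ∈ Ioo (0:ℝ) 1 := by
  rw [eq_vec v] at hv
  have h := re_im_of_mem (vec_mem_iff.1 hv)
  exact ⟨h.2.2.1, h.2.2.2⟩

theorem fsh_mem {δ : ℝ} (hδ : 0 < δ) (hδs : δ < 1 / 64) {v : Site 2} (hv : v ∈ TS δ) :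
    fsh δ v ∈ RS δ := by
  obtain ⟨hvm, hv16⟩ := hv
  have h1 := one_le_of_mem hδ hvm
  have him := im_mem_of_mem hvm
  obtain ⟨hb1, hb2⟩ := nxt_bounds hδ (5 / 8)
  have h1' : (1 : ℝ) ≤ v 0 := by exact_mod_cast h1
  have h16' : (v 0 : ℝ) ≤ 16 := by exact_mod_cast hv16
  refine ⟨?_, ?_⟩
  · show fsh δ v ∈ meshVertices Ω δ
    unfold fsh
    refine vec_mem_iff.2 (col_subset_Ω 0 ⟨⟨?_, ?_⟩, him⟩)
    · unfold l ib at *; rw [r_zero]; push_cast; nlinarith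
    · unfold ib at *; rw [r_zero]; push_cast; nlinarith
  · show (16 : ℤ) < v 0 + ib δ
    have : (16 : ℝ) < nxt δ (5 / 8) := by
      by_contra h; push Not at h; nlinarith
    have h16 : (16 : ℤ) < ib δ := by exact_mod_cast this
    linarith

/-- A room point beyond the image of the tail. -/
def rfar (δ : ℝ) : Site 2 := ![17 + ib δ, 1]

theorem rfar_mem {δ : ℝ} (hδ : 0 < δ) (hδs : δ < 1 / 64) : rfar δ ∈ RS δ := by
  obtain ⟨hb1, hb2⟩ := nxt_bounds hδ (5 / 8)
  refine ⟨?_, ?_⟩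
  · unfold rfar
    refine vec_mem_iff.2 (col_subset_Ω 0 ⟨⟨?_, ?_⟩, one_mem_Ioo hδ (by linarith)⟩)
    · unfold l ib; rw [r_zero]; push_cast; nlinarith
    · unfold ib; rw [r_zero]; push_cast; nlinarith
  · show (16 : ℤ) < 17 + ib δ
    have : (16 : ℝ) < nxt δ (5 / 8) := by
      by_contra h; push Not at h; nlinarith
    have h16 : (16 : ℤ) < ib δ := by exact_mod_cast this
    linarith

theorem rfar_not_mem_image {δ : ℝ} : rfar δ ∉ fsh δ '' TS δ := by
  rintro ⟨v, hv, hfv⟩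
  have h0 := congrFun hfv 0
  simp only [fsh, rfar, Matrix.cons_val_zero] at h0
  have := hv.2
  linarith

theorem finite_meshVertices {δ : ℝ} (hδ : 0 < δ) : (meshVertices Ω δ).Finite :=
  meshVertices_finite isBounded_Ω hδ

/-- **The tail is smaller than the room.** -/
theorem ncard_TS_lt {δ : ℝ} (hδ : 0 < δ) (hδs : δ < 1 / 64) : (TS δ).ncard < (RS δ).ncard := by
  rw [← Set.ncard_image_of_injective (TS δ) (fsh_injective δ)]
  apply Set.ncard_lt_ncard _ ((finite_meshVertices hδ).subset fun _ hv => hv.1)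
  refine ⟨?_, fun h => rfar_not_mem_image (h (rfar_mem hδ hδs))⟩
  rintro _ ⟨v, hv, rfl⟩
  exact fsh_mem hδ hδs hv

section Component

variable {δ : ℝ} (hδ : 0 < δ) (hδs : δ < 1 / 64)
include hδ hδs

/-- The main component: the component of the base point. -/
def mainC : (meshVertexGraph Ω δ).ConnectedComponent :=
  (meshVertexGraph Ω δ).connectedComponentMk ⟨v₀ δ, (v₀_mem_RS hδ hδs).1⟩

theorem RS_subset_main : RS δ ⊆ Subtype.val '' (mainC hδ hδs).supp := by
  intro v hv
  refine ⟨⟨v, hv.1⟩, ?_, rfl⟩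
  rw [SimpleGraph.ConnectedComponent.mem_supp_iff, mainC, SimpleGraph.ConnectedComponent.eq]
  obtain ⟨hu, hw, h⟩ := reach_v₀_of_mem_RS hδ hδs hv
  exact h

theorem image_supp_subset_TS {C : (meshVertexGraph Ω δ).ConnectedComponent}
    (hC : C ≠ mainC hδ hδs) : Subtype.val '' C.supp ⊆ TS δ := by
  rintro _ ⟨v, hv, rfl⟩
  refine ⟨v.2, ?_⟩
  by_contra hlt
  rw [not_le] at hlt
  obtain ⟨w, hw, hwv⟩ := RS_subset_main hδ hδs ⟨v.2, hlt⟩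
  have hwv' : w = v := Subtype.ext hwv
  subst hwv'
  rw [SimpleGraph.ConnectedComponent.mem_supp_iff] at hv hw
  exact hC (hv.symm.trans hw)

theorem ncard_supp_lt {C : (meshVertexGraph Ω δ).ConnectedComponent} (hC : C ≠ mainC hδ hδs) :
    C.supp.ncard < (mainC hδ hδs).supp.ncard := by
  have h1 : C.supp.ncard = (Subtype.val '' C.supp).ncard :=
    (Set.ncard_image_of_injective _ Subtype.val_injective).symm
  have h2 : (mainC hδ hδs).supp.ncard = (Subtype.val '' (mainC hδ hδs).supp).ncard :=
    (Set.ncard_image_of_injective _ Subtype.val_injective).symm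
  rw [h1, h2]
  have hfin : (Subtype.val '' (mainC hδ hδs).supp).Finite :=
    (finite_meshVertices hδ).subset (by rintro _ ⟨v, -, rfl⟩; exact v.2)
  calc (Subtype.val '' C.supp).ncard ≤ (TS δ).ncard :=
        Set.ncard_le_ncard (image_supp_subset_TS hδ hδs hC)
          ((finite_meshVertices hδ).subset fun _ hv => hv.1)
    _ < (RS δ).ncard := ncard_TS_lt hδ hδs
    _ ≤ (Subtype.val '' (mainC hδ hδs).supp).ncard := Set.ncard_le_ncard (RS_subset_main hδ hδs) hfin

theorem main_max (C : (meshVertexGraph Ω δ).ConnectedComponent) :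
    C.supp.ncard ≤ (mainC hδ hδs).supp.ncard := by
  by_cases hC : C = mainC hδ hδs
  · rw [hC]
  · exact (ncard_supp_lt hδ hδs hC).le

/-- **The discrete snake `Ω_δ` is the main component** (largest-component convention, by counting). -/
theorem meshDomain_eq : meshDomain Ω δ = Subtype.val '' (mainC hδ hδs).supp := by
  apply Subset.antisymm
  · intro x hx
    simp only [meshDomain, mem_iUnion] at hx
    obtain ⟨C, hC, hx⟩ := hx
    have hCm : C = mainC hδ hδs := by
      by_contra hne
      have h1 := ncard_supp_lt hδ hδs hne
      have h2 := hC (mainC hδ hδs)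
      omega
    rw [← hCm]; exact hx
  · intro x hx
    simp only [meshDomain, mem_iUnion]
    exact ⟨mainC hδ hδs, main_max hδ hδs, hx⟩

theorem reachable_dd_of_walk {u v : meshVertices Ω δ} (p : (meshVertexGraph Ω δ).Walk u v)
    (hu : u ∈ (mainC hδ hδs).supp) : (discreteDomainGraph Ω δ).Reachable u.1 v.1 := by
  induction p with
  | nil => exact SimpleGraph.Reachable.refl _
  | @cons a b c hadj p ih =>
    have hb : b ∈ (mainC hδ hδs).supp := by
      rw [SimpleGraph.ConnectedComponent.mem_supp_iff] at hu ⊢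
      rw [← hu]
      exact (SimpleGraph.ConnectedComponent.eq.2 hadj.reachable).symm
    have hdom : ∀ w : meshVertices Ω δ, w ∈ (mainC hδ hδs).supp → w.1 ∈ meshDomain Ω δ :=
      fun w hw => by rw [meshDomain_eq hδ hδs]; exact ⟨w, hw, rfl⟩
    have hadj' : (discreteDomainGraph Ω δ).Adj a.1 b.1 := by
      rw [discreteDomainGraph_adj_iff]
      refine ⟨?_, hdom a hu, hdom b hb⟩
      simpa [SimpleGraph.comap_adj] using hadj
    exact hadj'.reachable.trans (ih hb)

/-- **Room points are joined in `Ω_δ`.** -/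
theorem reachable_dd {u v : Site 2} (hu : u ∈ RS δ) (hv : v ∈ RS δ) :
    (discreteDomainGraph Ω δ).Reachable u v := by
  obtain ⟨hu', h0, h⟩ := (reach_v₀_of_mem_RS hδ hδs hu).trans (reach_v₀_of_mem_RS hδ hδs hv).symm
  obtain ⟨p⟩ := h
  have humain : (⟨u, hu'⟩ : meshVertices Ω δ) ∈ (mainC hδ hδs).supp := by
    obtain ⟨w, hw, hwu⟩ := RS_subset_main hδ hδs hu
    have : w = ⟨u, hu'⟩ := Subtype.ext hwu
    rw [← this]; exact hw
  exact reachable_dd_of_walk hδ hδs p humain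

end Component

/-! ### The depth `K δ`, the endpoints, and honesty of the approximation -/

theorem exists_r_le {δ : ℝ} (hδ : 0 < δ) : ∃ k, r k ≤ 64 * δ := by
  obtain ⟨k, hk⟩ := exists_pow_lt_of_lt_one (by positivity : (0:ℝ) < 64 * δ)
    (by norm_num : (1 / 2 : ℝ) < 1)
  exact ⟨k, hk.le⟩

/-- The depth `K δ`: the first level `k` with `r k ≤ 64 δ`. -/
def K (δ : ℝ) : ℕ := if h : 0 < δ then Nat.find (exists_r_le h) else 0

theorem r_K_le {δ : ℝ} (hδ : 0 < δ) : r (K δ) ≤ 64 * δ := by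
  rw [K, dif_pos hδ]; exact Nat.find_spec (exists_r_le hδ)

/-- The column of depth `K δ` is resolved: `16 δ < l (K δ)` (for `δ < 1/64`). -/
theorem lt_l_K {δ : ℝ} (hδ : 0 < δ) (hδs : δ < 1 / 64) : 16 * δ < l (K δ) := by
  rw [K, dif_pos hδ]
  rcases Nat.eq_zero_or_pos (Nat.find (exists_r_le hδ)) with h0 | hpos
  · rw [h0]; unfold l; rw [r_zero]; linarith
  · have hmin := Nat.find_min (exists_r_le hδ) (Nat.sub_one_lt_of_lt hpos)
    have hN : Nat.find (exists_r_le hδ) = (Nat.find (exists_r_le hδ) - 1) + 1 := by omega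
    rw [hN]; unfold l; rw [r_succ]
    push Not at hmin
    linarith

theorem lt_r_K {δ : ℝ} (hδ : 0 < δ) (hδs : δ < 1 / 64) : 16 * δ < r (K δ) :=
  (lt_l_K hδ hδs).trans (l_lt_r _)

/-- If `64 δ < r n` then the depth exceeds `n`. -/
theorem lt_K_of {δ : ℝ} (hδ : 0 < δ) {n : ℕ} (hn : 64 * δ < r n) : n < K δ := by
  by_contra h
  have := r_antitone (not_lt.1 h)
  have := r_K_le hδ
  linarith

/-- The starting site `a δ`: first lattice abscissa of the column of depth `K δ`, row `1`. -/
def aδ (δ : ℝ) : Site 2 := ![nxt δ (l (K δ)), 1]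

/-- The target site `b δ`: the base point of `col 0`. -/
def bδ (δ : ℝ) : Site 2 := v₀ δ

theorem a_mem_col {δ : ℝ} (hδ : 0 < δ) (hδs : δ < 1 / 64) :
    (⟨δ * (nxt δ (l (K δ))), δ * ((1 : ℤ) : ℝ)⟩ : ℂ) ∈ col (K δ) := by
  obtain ⟨h1, h2⟩ := nxt_bounds hδ (l (K δ))
  have hr := lt_r_K hδ hδs
  have hw : l (K δ) + δ < r (K δ) := by unfold l at *; linarith
  exact ⟨⟨h1, by linarith⟩, one_mem_Ioo hδ (by linarith)⟩

theorem meshPoint_aδ (δ : ℝ) : meshPoint δ (aδ δ) = ⟨δ * (nxt δ (l (K δ))), δ * ((1 : ℤ) : ℝ)⟩ := by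
  rw [aδ, meshPoint_vec]

theorem aδ_mem_RS {δ : ℝ} (hδ : 0 < δ) (hδs : δ < 1 / 64) : aδ δ ∈ RS δ := by
  refine ⟨?_, ?_⟩
  · rw [mem_meshVertices_iff, meshPoint_aδ]
    exact col_subset_Ω _ (a_mem_col hδ hδs)
  · show (16 : ℤ) < nxt δ (l (K δ))
    obtain ⟨h1, -⟩ := nxt_bounds hδ (l (K δ))
    have hl := lt_l_K hδ hδs
    have : (16 : ℝ) < nxt δ (l (K δ)) := by
      by_contra h; push Not at h; nlinarith
    exact_mod_cast this

theorem norm_meshPoint_aδ_le {δ : ℝ} (hδ : 0 < δ) :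
    ‖meshPoint δ (aδ δ)‖ ≤ 66 * δ := by
  rw [meshPoint_aδ]
  obtain ⟨h1, h2⟩ := nxt_bounds hδ (l (K δ))
  have hl : l (K δ) ≤ r (K δ) := (l_lt_r _).le
  have hr := r_K_le hδ
  refine (norm_le_abs_re_add_abs_im _).trans ?_
  have hpos : 0 < δ * (nxt δ (l (K δ)) : ℝ) := (l_pos _).trans h1
  simp only [Int.cast_one, mul_one, abs_of_pos hpos, abs_of_pos hδ]
  linarith

theorem dist_meshPoint_bδ_le {δ : ℝ} (hδ : 0 < δ) :
    dist (meshPoint δ (bδ δ)) ((5 / 8 : ℝ) : ℂ) ≤ 2 * δ := by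
  rw [bδ, v₀, meshPoint_vec, Complex.dist_eq]
  obtain ⟨h1, h2⟩ := nxt_bounds hδ (5 / 8)
  refine (norm_le_abs_re_add_abs_im _).trans ?_
  simp only [sub_re, sub_im, ofReal_re, ofReal_im, Int.cast_one, mul_one, sub_zero, abs_of_pos hδ]
  unfold ib
  rw [abs_of_pos (by linarith)]
  linarith

theorem tendsto_aδ : Tendsto (fun δ => meshPoint δ (aδ δ)) (𝓝[>] (0 : ℝ)) (𝓝 0) := by
  rw [Metric.tendsto_nhds]
  intro ε hε
  filter_upwards [Ioo_mem_nhdsGT (by positivity : 0 < ε / 67)] with δ hδ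
  have hε' : δ < ε / 67 := hδ.2
  rw [dist_zero_right]
  linarith [norm_meshPoint_aδ_le hδ.1]

theorem tendsto_bδ : Tendsto (fun δ => meshPoint δ (bδ δ)) (𝓝[>] (0 : ℝ)) (𝓝 ((5 / 8 : ℝ) : ℂ)) := by
  rw [Metric.tendsto_nhds]
  intro ε hε
  filter_upwards [Ioo_mem_nhdsGT (by positivity : 0 < ε / 3)] with δ hδ
  linarith [dist_meshPoint_bδ_le hδ.1, hδ.2]

theorem eventually_reachable :
    ∀ᶠ δ in 𝓝[>] (0 : ℝ), (discreteDomainGraph Ω δ).Reachable (aδ δ) (bδ δ) := by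
  filter_upwards [Ioo_mem_nhdsGT (by norm_num : (0:ℝ) < 1 / 64)] with δ hδ
  exact reachable_dd hδ.1 hδ.2 (aδ_mem_RS hδ.1 hδ.2) (v₀_mem_RS hδ.1 hδ.2)

theorem isProbabilityMeasure_law_snake {δ : ℝ} (hδ : 0 < δ) (hδs : δ < 1 / 64) :
    IsProbabilityMeasure (law Ω δ (aδ δ) (bδ δ)) :=
  isProbabilityMeasure_law isBounded_Ω hδ
    (reachable_dd hδ hδs (aδ_mem_RS hδ hδs) (v₀_mem_RS hδ hδs))

/-! ### Forcing: every SAW traverses the fixed shell `D((1/2, 0); 3/5, 7/10)` `K δ / 2` times -/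

/-- Centre of the forcing shell. -/
def x₀ : ℂ := ⟨1 / 2, 0⟩

theorem dist_le_of_low {z : ℂ} (hre : 0 ≤ z.re ∧ z.re ≤ 1) (him : 0 ≤ z.im ∧ z.im ≤ 1 / 4) :
    dist z x₀ ≤ 3 / 5 := by
  rw [Complex.dist_eq]
  have h : ‖z - x₀‖ ^ 2 ≤ (3 / 5) ^ 2 := by
    rw [Complex.sq_norm, Complex.normSq_apply]
    simp only [sub_re, sub_im, x₀]
    nlinarith
  exact (pow_le_pow_iff_left₀ (norm_nonneg _) (by norm_num) two_ne_zero).1 h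

theorem le_dist_of_high {z : ℂ} (him : 3 / 4 ≤ z.im) : 7 / 10 ≤ dist z x₀ := by
  refine le_trans ?_ (abs_im_sub_le_dist z x₀)
  simp only [x₀, sub_zero]
  rw [abs_of_nonneg (by linarith)]
  linarith

/-- **Forcing.** For `0 < δ < 1/64`, EVERY self-avoiding walk of the discrete snake from `a δ`
to `b δ` traverses the fixed shell `D(x₀; 3/5, 7/10)` at least `K δ / 2` times: by the
intermediate value theorem its polyline crosses the `K δ` walls `re = m k`, `k < K δ`, in
decreasing order of `k`, and on a wall the ordinate is pinned alternately below `1/4` (even `k`) and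
above `3/4` (odd `k`). -/
theorem forcing {δ : ℝ} (hδ : 0 < δ) (hδs : δ < 1 / 64) (γ : DomainSAW Ω δ (aδ δ) (bδ δ)) :
    (⟨γ.walk.toCurve (meshPoint δ)⟩ : Curve ℂ).HasTraversals (K δ / 2) x₀ (3 / 5) (7 / 10) := by
  set p : C(I, ℂ) := γ.walk.toCurve (meshPoint δ) with hp
  have hf : Continuous fun s : I => (p s).re := continuous_re.comp p.continuous
  have hcl : ∀ s, p s ∈ closure Ω := fun s => by
    refine range_toCurve_subset (meshPoint δ) (S := closure Ω) (fun x y hxy => ?_) γ.walk ?_ ⟨s, rfl⟩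
    · exact (meshGraph_adj_iff.1 (discreteDomainGraph_adj_iff.1 hxy).1).2
    · rw [meshPoint_aδ]; exact subset_closure (col_subset_Ω _ (a_mem_col hδ hδs))
  have hp0 : (p 0).re = δ * (nxt δ (l (K δ)) : ℝ) := by
    rw [hp, SimpleGraph.Walk.toCurve_apply_zero, meshPoint_aδ]
  have hp1 : (p 1).re = δ * (nxt δ (5 / 8) : ℝ) := by
    rw [hp, toCurve_apply_one, bδ, v₀, meshPoint_vec]; rfl
  set N : ℕ := K δ with hN
  rcases Nat.eq_zero_or_pos N with hN0 | hNpos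
  · rw [hN0]; exact Curve.hasTraversals_zero _ _ _ _
  -- the increasing levels `u j = m (N - 1 - j)`
  set u : ℕ → ℝ := fun j => m (N - 1 - j) with hu
  have hmono : ∀ j < N - 1, u j < u (j + 1) := fun j hj => m_antitone_strict (by omega)
  have hf0 : (p 0).re < u 0 := by
    rw [hp0]
    show δ * (nxt δ (l (K δ)) : ℝ) < m (N - 1 - 0)
    obtain ⟨-, h2⟩ := nxt_bounds hδ (l (K δ))
    have hr := lt_r_K hδ hδs
    have hK : N - 1 - 0 + 1 = K δ := by omega
    have hm : m (N - 1 - 0) = 9 / 8 * r (K δ) := by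
      rw [← hK, r_succ]; unfold m; ring
    rw [hm]; unfold l at h2 ⊢; linarith
  have hf1 : ∀ j ≤ N - 1, u j < (p 1).re := fun j _ => by
    rw [hp1]
    obtain ⟨h1, -⟩ := nxt_bounds hδ (5 / 8)
    have : u j ≤ m 0 := by
      show m (N - 1 - j) ≤ m 0
      unfold m; have := r_antitone (Nat.zero_le (N - 1 - j)); linarith
    unfold m at this; rw [r_zero] at this; linarith
  obtain ⟨t, ht, hlt⟩ := exists_chain hf u (N - 1) hmono hf0 hf1
  have hwin : ∀ j ≤ N - 1, (p (t j)).im ∈ cwin (N - 1 - j) := fun j hj =>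
    im_mem_cwin_of_re_eq_m (hcl _) (ht j hj)
  have hre01 : ∀ s, 0 ≤ (p s).re ∧ (p s).re ≤ 1 := fun s =>
    ⟨(re_im_of_mem_closure (hcl s)).1, (re_im_of_mem_closure (hcl s)).2.1⟩
  -- low / high dichotomy on a wall
  have hlow : ∀ j ≤ N - 1, Even (N - 1 - j) → dist (p (t j)) x₀ ≤ 3 / 5 := fun j hj he => by
    have hw := hwin j hj
    simp only [cwin, if_pos he] at hw
    exact dist_le_of_low (hre01 _) hw
  have hhigh : ∀ j ≤ N - 1, ¬ Even (N - 1 - j) → 7 / 10 ≤ dist (p (t j)) x₀ := fun j hj he => by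
    have hw := hwin j hj
    simp only [cwin, if_neg he] at hw
    exact le_dist_of_high hw.1
  refine ⟨fun i => t (2 * i), fun i => t (2 * i + 1), fun i => ?_, fun i j hij => ?_⟩
  · have hi : (i : ℕ) < N / 2 := i.isLt
    have h2i : 2 * (i : ℕ) + 1 ≤ N - 1 := by omega
    refine ⟨(chain_lt hlt (a := 2 * i) (b := 2 * i + 1) (by omega) h2i).le, ?_⟩
    have hsucc : N - 1 - 2 * (i : ℕ) = (N - 1 - (2 * i + 1)) + 1 := by omega
    by_cases he : Even (N - 1 - (2 * (i : ℕ) + 1))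
    · -- second wall low, first wall high
      have hne : ¬ Even (N - 1 - 2 * (i : ℕ)) := by rw [hsucc, Nat.even_add_one]; exact not_not.2 he
      exact Or.inr ⟨hhigh _ (by omega) hne, hlow _ h2i he⟩
    · have he' : Even (N - 1 - 2 * (i : ℕ)) := by rw [hsucc, Nat.even_add_one]; exact he
      exact Or.inl ⟨hlow _ (by omega) he', hhigh _ h2i he⟩
  · have hi := i.isLt; have hj := j.isLt
    have hij' : (i : ℕ) < j := hij
    exact chain_lt hlt (a := 2 * i + 1) (b := 2 * j) (by omega) (by omega)

/-- **Escape.** For every compact set of curve classes and every `δ₀ > 0` there is a mesh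
`δ ∈ (0, δ₀]` at which the snake SAW law is an honest probability measure giving the compact set
mass ZERO (all small meshes of depth `K δ > 2 k₀` do, `k₀` the traversal bound of the compact set). -/
theorem escapes {𝒦 : Set (CurveClass ℂ)} (h𝒦 : IsCompact 𝒦) {δ₀ : ℝ} (hδ₀ : 0 < δ₀) :
    ∃ δ ∈ Set.Ioc (0 : ℝ) δ₀, IsProbabilityMeasure (law Ω δ (aδ δ) (bδ δ)) ∧
      law Ω δ (aδ δ) (bδ δ) ((fun γ : DomainSAW Ω δ (aδ δ) (bδ δ) => γ.curve) ⁻¹' 𝒦ᶜ) = 1 := by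
  obtain ⟨k₀, hk₀⟩ := exists_forall_not_hasTraversals_of_isCompact h𝒦 x₀
    (r := 3 / 5) (R := 7 / 10) (by norm_num)
  -- a mesh in `(0, δ₀]`, below `1/64`, of depth `K δ > 2 k₀`
  set δ : ℝ := min δ₀ (min (1 / 128) (r (2 * k₀) / 128)) with hδ_def
  have hr0 := r_pos (2 * k₀)
  have hδpos : 0 < δ := lt_min hδ₀ (lt_min (by norm_num) (by positivity))
  have hδle : δ ≤ δ₀ := min_le_left _ _
  have hδs : δ < 1 / 64 := by
    have : δ ≤ 1 / 128 := (min_le_right _ _).trans (min_le_left _ _); linarith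
  have hdepth : 2 * k₀ < K δ := lt_K_of hδpos (by
    have : δ ≤ r (2 * k₀) / 128 := (min_le_right _ _).trans (min_le_right _ _); linarith)
  haveI := isProbabilityMeasure_law_snake hδpos hδs
  refine ⟨δ, ⟨hδpos, hδle⟩, ‹_›, ?_⟩
  have hpre : (fun γ : DomainSAW Ω δ (aδ δ) (bδ δ) => γ.curve) ⁻¹' 𝒦ᶜ = univ := by
    refine eq_univ_of_forall fun γ => ?_
    show γ.curve ∉ 𝒦
    intro hγ
    exact hk₀ ⟨γ.walk.toCurve (meshPoint δ)⟩ hγ ((forcing hδpos hδs γ).of_le (by omega))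
  rw [hpre, measure_univ]

end Snake

/-! ### Boundary regularity is load-bearing: the crux over general bounded open connected sets is FALSE -/

/-- The crux with the Dobrushin (JORDAN) domain replaced by an arbitrary bounded open connected set
with two distinct marked FRONTIER points — i.e. keeping the fields `isOpen`, `isBounded`,
`isConnected`, `pt_mem_frontier`, `pt_injective` of `DobrushinDomain` and dropping only the
boundary LOOP (`boundary`, `continuous_boundary`, `injOn_boundary`, `range_boundary`: local
connectivity of `∂Ω`). -/
def CruxOverDomains : Prop :=
  ∀ (Ω : Set ℂ) (p q : ℂ) (a b : ℝ → Site 2), IsOpen Ω → Bornology.IsBounded Ω → IsConnected Ω →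
    p ∈ frontier Ω → q ∈ frontier Ω → p ≠ q →
    (∀ᶠ δ in 𝓝[>] (0 : ℝ), (discreteDomainGraph Ω δ).Reachable (a δ) (b δ)) →
    Tendsto (fun δ => meshPoint δ (a δ)) (𝓝[>] 0) (𝓝 p) →
    Tendsto (fun δ => meshPoint δ (b δ)) (𝓝[>] 0) (𝓝 q) →
    ∃ δ₀ : ℝ, 0 < δ₀ ∧ IsTightMeasureSet
      ((fun δ => (law Ω δ (a δ) (b δ)).map (fun γ => γ.curve)) '' Set.Ioc 0 δ₀)

/-- `CruxOverDomains` implies the crux (a Dobrushin domain is such a set). [folklore] -/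
theorem crux_of_overDomains (h : CruxOverDomains) :
    Summit.CriticalPhenomena.SAWScalingLimit.Theses.SAWRenewalTightness.EventualTight :=
  fun D a b hab => h D.carrier (D.pt 0) (D.pt 1) a b D.isOpen D.isBounded D.isConnected
    (D.pt_mem_frontier 0) (D.pt_mem_frontier 1) (fun e => absurd (D.pt_injective e) (by decide))
    hab.reachable hab.tendsto_fst hab.tendsto_snd

/-- **Boundary regularity is load-bearing: `CruxOverDomains` is FALSE.** Witness: the dyadic snake
`Snake.Ω` with marked frontier points `0` (at the accumulation of the columns) and `5/8`, and the
honest endpoint approximation `Snake.aδ → 0`, `Snake.bδ → 5/8` (joined in `Ω_δ` for `δ < 1/64`, where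
`Ω_δ` is identified by counting as everything of abscissa `> 16 δ`). Every SAW at mesh `δ` traverses
the FIXED shell `D((1/2,0); 3/5, 7/10)` at least `K δ / 2 → ∞` times (`Snake.forcing`), while on a
compact set of curve classes the number of traversals of a fixed shell is bounded
(`exists_forall_not_hasTraversals_of_isCompact`): for small `δ` the probability law gives the compact
set mass `0`. So ANY proof of `EventualTight` must use the Jordan boundary loop of `D` (local
connectivity of `∂Ω` at the marked points) — openness, boundedness, connectedness and
`pt i ∈ frontier` do not suffice. [folklore] -/
theorem eventualTight_false_without_jordan : ¬ CruxOverDomains := by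
  intro h
  obtain ⟨δ₀, hδ₀, hT⟩ := h Snake.Ω 0 ((5 / 8 : ℝ) : ℂ) Snake.aδ Snake.bδ Snake.isOpen_Ω
    Snake.isBounded_Ω Snake.isConnected_Ω Snake.zero_mem_frontier Snake.q_mem_frontier
    (by norm_num) Snake.eventually_reachable Snake.tendsto_aδ Snake.tendsto_bδ
  rw [isTightMeasureSet_iff_exists_isCompact_measure_compl_le] at hT
  obtain ⟨K, hK, hμ⟩ := hT 2⁻¹ (by simp)
  obtain ⟨δ, hδ, _, h1⟩ := Snake.escapes hK hδ₀
  have hle := hμ _ ⟨δ, hδ, rfl⟩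
  rw [Measure.map_apply (DomainSAW.measurable_of_top _) hK.isClosed.measurableSet.compl, h1] at hle
  exact absurd hle (by norm_num)

/-- The same witness refutes the ALONG-THE-MESH form (the shape of the twin stmt-1881,
`IsTightAlongMesh`) over bounded open connected sets: for every compact set of curve classes the
snake laws give it mass `0` at meshes arbitrarily close to `0`. [folklore] -/
theorem tightAlongMesh_false_without_jordan :
    ¬ (∀ (Ω : Set ℂ) (p q : ℂ) (a b : ℝ → Site 2), IsOpen Ω → Bornology.IsBounded Ω →
        IsConnected Ω → p ∈ frontier Ω → q ∈ frontier Ω → p ≠ q →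
        (∀ᶠ δ in 𝓝[>] (0 : ℝ), (discreteDomainGraph Ω δ).Reachable (a δ) (b δ)) →
        Tendsto (fun δ => meshPoint δ (a δ)) (𝓝[>] 0) (𝓝 p) →
        Tendsto (fun δ => meshPoint δ (b δ)) (𝓝[>] 0) (𝓝 q) →
        IsTightAlongMesh (fun δ (γ : DomainSAW Ω δ (a δ) (b δ)) => γ.curve)
          (fun δ => law Ω δ (a δ) (b δ))) := by
  intro h
  obtain ⟨K, hK, hev⟩ := h Snake.Ω 0 ((5 / 8 : ℝ) : ℂ) Snake.aδ Snake.bδ Snake.isOpen_Ω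
    Snake.isBounded_Ω Snake.isConnected_Ω Snake.zero_mem_frontier Snake.q_mem_frontier
    (by norm_num) Snake.eventually_reachable Snake.tendsto_aδ Snake.tendsto_bδ 2⁻¹ (by simp)
  obtain ⟨δ₁, hδ₁, hsub⟩ := mem_nhdsGT_iff_exists_Ioo_subset.1 hev
  have hδ₁pos : (0 : ℝ) < δ₁ := hδ₁
  obtain ⟨δ, hδ, _, h1⟩ := Snake.escapes hK (half_pos hδ₁pos)
  have hle : (law Snake.Ω δ (Snake.aδ δ) (Snake.bδ δ))
      ((fun γ : DomainSAW Snake.Ω δ (Snake.aδ δ) (Snake.bδ δ) => γ.curve) ⁻¹' Kᶜ) ≤ 2⁻¹ :=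
    hsub ⟨hδ.1, hδ.2.trans_lt (half_lt_self hδ₁pos)⟩
  rw [h1] at hle
  exact absurd hle (by norm_num)


/-- **Contrast: a JORDAN boundary traverses every genuine shell only finitely often.** The boundary
loop of a Dobrushin domain, read on one period as a parametrised curve, has finitely many separate
traversals of `D(x; r, R)`, `r < R` (uniform continuity, `Curve.exists_not_hasTraversals`). This is the
finiteness that the snake lacks (its frontier is not a curve at the accumulation segment) and that a
proof of the crux has to exploit: per fixed shell the boundary can FORCE only boundedly many
traversals, uniformly in the mesh. [folklore] -/
theorem jordan_boundary_finitely_many_traversals (D : DobrushinDomain) (x : ℂ) {r R : ℝ}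
    (hrR : r < R) :
    ∃ k, ¬ (⟨⟨fun t : I => D.boundary t, D.continuous_boundary.comp continuous_subtype_val⟩⟩ :
      Curve ℂ).HasTraversals k x r R :=
  Curve.exists_not_hasTraversals _ x hrR


/-! ## §6 Unit `cdisprove-stmt-CriticalPhenomena-1881` (the ALONG-THE-MESH twin, bet route
`SAWTwistedSelfEnergy`), cycle 1 — by-name hooks, necessity, and the picked line's atom `UMA`

The twin stmt-1881 is the `IsTightAlongMesh` form of the crux (same decl body in the routes
SAWTwistedSelfEnergy, SAWLaplacianWalk, SAWExcursionCardy, SAWAsymptoticMorera, SAWStressTensor,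
SAWQuadrupoleWard, SAWSchrammPassage, SAWImaginaryGeometry, SAWTipEnvironment, …). Everything of §1–§5
transfers verbatim (the along-the-mesh conclusions `tightAlongMesh_false_without_jordan` above and the
landed `Theorems/EventualTight/Negative/AlongMeshEndpointLimitsFalse.lean`,
`alongMesh_false_without_endpointLimits`, p149974). This section adds, CHECKED:
* `crux1881_of_crux` / `crux_of_crux1881` — the two forms are equivalent BY NAME (set form ⇒ along the
  mesh: Literature bridge; along the mesh ⇒ set form: shrink `δ₀` into the honest range `a δ ≠ b δ` and
  add the window-compactness container of the meshes `[δ₁, δ₀]`, `exists_isCompact_forall_curve_mem_zd`);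
* `crux1881_necessary` / `not_summit_of_not_crux1881` — `SAWScalingLimit → Crux1881` (re-hosted for
  landing as `Theorems/EventualTight/Negative/AlongMeshNecessary.lean`);
* the `-- Line SketchIdeator2_1881` analysis of the picked line's ONE open statement `UMA` (the
  unordered-Markov fibre atom of card `unordered-markov-fibres`, restated verbatim in `UMALine`):
  `UMALine.hasTraversals_two_of_one` (a curve with both endpoints outside `B(y,R₂)` that reaches
  `B̄(y,r₁)`, `r₁ < r₂ < R₂`, traverses `D(y;r₂,R₂)` twice), hence `UMALine.event_eq_empty_of_budget_le_two`
  (for coarse budget `m ≤ 2` and lattice endpoints outside `B(y,2s)` the UMA event is EMPTY: the atom has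
  content only from `m = 3`, "exactly one dive", or with an endpoint inside the disc), and
  `UMALine.topScale_of_crux1881` (when `Ω ⊆ B(y, 2s)` every fibre is everything and the coarse shell is
  never traversed: these instances of UMA are EXACTLY per-shell tightness of macroscopic shells and follow
  from the crux itself — so UMA sandwiches the crux: `UMA → Crux1881 → UMA∣top-scale`);
  `UMALine.uma_resists` records why no fibre FORCES the bad event (attack log).
-/

section AlongMesh1881

/-- The along-the-mesh twin stmt-CriticalPhenomena-1881 by name (bet route `SAWTwistedSelfEnergy`). -/
abbrev Crux1881 : Prop :=
  _root_.Summit.CriticalPhenomena.SAWScalingLimit.Theses.SAWTwistedSelfEnergy.EventualTight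

/-- **Set form ⇒ along the mesh** (stmt-1372 ⇒ stmt-1881): a tight image of `(0, δ₀]` is tight along
`𝓝[>] 0` (Literature bridge `isTightAlongMesh_of_isTightMeasureSet_image`). [folklore] -/
theorem crux1881_of_crux (h : Crux) : Crux1881 := fun D a b hab => by
  obtain ⟨δ₀, hδ₀, hT⟩ := h D a b hab
  exact isTightAlongMesh_of_isTightMeasureSet_image
    (Eventually.of_forall fun δ => (DomainSAW.measurable_of_top _).aemeasurable) hδ₀ hT

/-- **Along the mesh ⇒ set form** (stmt-1881 ⇒ stmt-1372). Choose `δ₀` inside the honest range where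
`a δ ≠ b δ` (the two limits are the distinct marked points); for a given `ε` the along-the-mesh compact
set serves the meshes below its threshold `δ₁`, and the meshes in `[δ₁, δ₀]` are served by the
window-compactness container of ALL SAW curve classes of `Ω` at those meshes
(`exists_isCompact_forall_curve_mem_zd`, distinct endpoints). [folklore] -/
theorem crux_of_crux1881 (h : Crux1881) : Crux := by
  intro D a b hab
  -- the honest range: distinct lattice endpoints
  have hne : D.pt 0 ≠ D.pt 1 := fun e => absurd (D.pt_injective e) (by decide)
  obtain ⟨U, V, hU, hV, hUa, hVb, hUV⟩ := t2_separation hne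
  have hdist : ∀ᶠ δ in 𝓝[>] (0 : ℝ), a δ ≠ b δ := by
    filter_upwards [hab.tendsto_fst (hU.mem_nhds hUa), hab.tendsto_snd (hV.mem_nhds hVb)]
      with δ ha hb hab'
    have ha' : meshPoint δ (a δ) ∈ U := ha
    have hb' : meshPoint δ (b δ) ∈ V := hb
    rw [hab'] at ha'
    exact Set.disjoint_iff.1 hUV ⟨ha', hb'⟩
  obtain ⟨δ₂, hδ₂, hsub₂⟩ := mem_nhdsGT_iff_exists_Ioo_subset.1 hdist
  have hδ₂pos : (0 : ℝ) < δ₂ := hδ₂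
  refine ⟨δ₂ / 2, half_pos hδ₂pos, ?_⟩
  rw [isTightMeasureSet_iff_exists_isCompact_measure_compl_le]
  intro ε hε
  obtain ⟨K₁, hK₁, hev⟩ := h D a b hab ε hε
  obtain ⟨δ₁, hδ₁, hsub₁⟩ := mem_nhdsGT_iff_exists_Ioo_subset.1 hev
  have hδ₁pos : (0 : ℝ) < δ₁ := hδ₁
  -- the container of the meshes in `[min δ₁ δ₂ / 2, δ₂ / 2]`
  obtain ⟨C, hC, hCmem⟩ :=
    _root_.Summit.CriticalPhenomena.SAWScalingLimit.Theorems.SubseqIdentification.Negative.exists_isCompact_forall_curve_mem_zd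
      (Ω := D.carrier) D.isBounded
    (lo := min δ₁ δ₂ / 2) (hi := δ₂ / 2) (by positivity)
  refine ⟨K₁ ∪ C, hK₁.union hC, ?_⟩
  rintro μ ⟨δ, hδ, rfl⟩
  have hδ2 : δ ∈ Set.Ioo 0 δ₂ := ⟨hδ.1, hδ.2.trans_lt (half_lt_self hδ₂pos)⟩
  have hab' : a δ ≠ b δ := hsub₂ hδ2
  rw [Measure.map_apply (DomainSAW.measurable_of_top _) (hK₁.union hC).isClosed.measurableSet.compl]
  by_cases hsmall : δ < δ₁
  · refine le_trans (measure_mono ?_) (hsub₁ ⟨hδ.1, hsmall⟩)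
    intro γ hγ hγK
    exact hγ (Or.inl hγK)
  · have hwin : δ ∈ Set.Icc (min δ₁ δ₂ / 2) (δ₂ / 2) := by
      refine ⟨?_, hδ.2⟩
      have : min δ₁ δ₂ ≤ δ₁ := min_le_left _ _
      push Not at hsmall
      linarith
    have hempty : (fun γ : DomainSAW D.carrier δ (a δ) (b δ) => γ.curve) ⁻¹' (K₁ ∪ C)ᶜ = ∅ :=
      Set.eq_empty_of_forall_notMem fun γ hγ => hγ (Or.inr (hCmem δ hwin _ _ hab' γ))
    rw [hempty, measure_empty]
    exact bot_le

/-- **NECESSITY by name**: the along-the-mesh crux stmt-1881 follows from the summit conjunct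
(`SAWScalingLimit`): convergence in law to chordal SLE_{8/3} ⇒ a tight set of pushed laws on an initial
mesh interval (landed `TightnessNecessary.exists_isTightMeasureSet_image_of_convergesInLawToSLE`) ⇒
tight along the mesh. So a kill of stmt-1881 kills the LSW conjecture as typed. [folklore] -/
theorem crux1881_necessary (h : SAW.SAWScalingLimit) : Crux1881 := fun D a b hab => by
  obtain ⟨δ₀, hδ₀, hT⟩ :=
    _root_.Summit.CriticalPhenomena.SAWScalingLimit.Theorems.EventualTight.Negative.exists_isTightMeasureSet_image_of_convergesInLawToSLE
      hab (h D a b hab)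
  exact isTightAlongMesh_of_isTightMeasureSet_image
    (Eventually.of_forall fun δ => (DomainSAW.measurable_of_top _).aemeasurable) hδ₀ hT

/-- Contrapositive (the refuter-admissible negative form, re-hosted for landing as
`Theorems/EventualTight/Negative/AlongMeshNecessary.lean`). [folklore] -/
theorem not_summit_of_not_crux1881 (h : ¬ Crux1881) : ¬ SAW.SAWScalingLimit :=
  fun h' => h (crux1881_necessary h')

end AlongMesh1881

/-! ### `-- Line SketchIdeator2_1881`: the unordered-Markov fibre atom `UMA` (picked 2026-08-17)

The lead of stmt-1881 picked `Cruxes/EventualTight/SketchIdeator2_1881.lean` (card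
`Ideas/unordered-markov-fibres.md`): its ONE open statement is `UMA` below (restated VERBATIM, with its
two auxiliary definitions, so that this work file does not import an unbuilt `Cruxes` module; the
ideator's glue `eventualTight_of_UMA : UMA → Crux1881` is kernel-checked there). -/

namespace UMALine

/-- The polyline of a domain SAW at mesh `δ`, as a curve (verbatim `IdeatorR1K2.polyline`). -/
def polyline {Ω : Set ℂ} {δ : ℝ} {a b : Site 2} (γ : DomainSAW Ω δ a b) : Curve ℂ :=
  ⟨γ.walk.toCurve (meshPoint δ)⟩

/-- Outside agreement at radius `r` about `y` (verbatim `IdeatorR1K2.OutAgree`): the same lattice edges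
among those with an endpoint at distance `≥ r` from `y`. -/
def OutAgree {Ω : Set ℂ} {δ : ℝ} {a b : Site 2} (y : ℂ) (r : ℝ) (γ γ₀ : DomainSAW Ω δ a b) : Prop :=
  ∀ e : Sym2 (Site 2), (∃ v : Site 2, v ∈ e ∧ r ≤ dist (meshPoint δ v) y) →
    (e ∈ γ.walk.edges ↔ e ∈ γ₀.walk.edges)

/-- **UMA** (verbatim `IdeatorR1K2.UMA`, the picked line's one stub): for every fibre of the unordered
outside trace at radius `2s`, the joint event "`k` traversals of `D(y; ts, s)` and `< m` of
`D(y; 6s/5, 2s)`" has conditional mass `≤ θ`; thresholds per `(D, a, b, y, s, t, m)`. -/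
def UMA : Prop :=
  ∀ (D : DobrushinDomain) (a b : ℝ → Site 2), IsEndpointApprox D a b →
    ∀ (y : ℂ) (s t : ℝ), 0 < s → 0 < t → t < 1 → ∀ (m : ℕ) (θ : ℝ), 0 < θ →
      ∃ (k : ℕ) (δ₀ : ℝ), 0 < δ₀ ∧ ∀ δ ∈ Set.Ioc (0 : ℝ) δ₀,
        ∀ γ₀ : DomainSAW D.carrier δ (a δ) (b δ),
          law D.carrier δ (a δ) (b δ)
              {γ | OutAgree y (2 * s) γ γ₀ ∧ (polyline γ).HasTraversals k y (t * s) s ∧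
                ¬ (polyline γ).HasTraversals m y (6 * s / 5) (2 * s)}
            ≤ ENNReal.ofReal θ * law D.carrier δ (a δ) (b δ) {γ | OutAgree y (2 * s) γ γ₀}

/-- **Fine ⇒ two coarse for rim-anchored strands.** A curve whose two ENDPOINTS lie outside the open
ball `B(y, R₂)` and which reaches the closed ball `B̄(y, r₁)` (one traversal of any shell with inner
radius `r₁`) traverses `D(y; r₂, R₂)` at least TWICE whenever `r₁ < r₂ < R₂`: once on the way in, once on
the way out (the two parameter intervals are separated using continuity at the deep time). [folklore] -/
theorem hasTraversals_two_of_one (γ : Curve ℂ) (y : ℂ) {r₁ R₁ r₂ R₂ : ℝ}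
    (h : γ.HasTraversals 1 y r₁ R₁) (h12 : r₁ < r₂) (hrR : r₂ < R₂)
    (h0 : R₂ ≤ dist (γ 0) y) (h1 : R₂ ≤ dist (γ 1) y) : γ.HasTraversals 2 y r₂ R₂ := by
  obtain ⟨s, t, hst, -⟩ := h
  -- a deep time `u`
  obtain ⟨u, hu⟩ : ∃ u : I, dist (γ u) y ≤ r₁ := by
    rcases (hst 0).2 with ⟨hs0, -⟩ | ⟨-, ht0⟩
    · exact ⟨s 0, hs0⟩
    · exact ⟨t 0, ht0⟩
  have hu1 : (u : ℝ) < 1 := by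
    rcases lt_or_eq_of_le u.2.2 with hlt | heq
    · exact hlt
    · exfalso
      have : u = 1 := Subtype.ext heq
      rw [this] at hu
      linarith
  -- continuity of `v ↦ dist (γ v) y` at `u`
  have hcont : Continuous fun v : I => dist (γ v) y := (γ.continuous.dist continuous_const)
  obtain ⟨η, hη, hηu⟩ := Metric.continuous_iff.1 hcont u (r₂ - r₁) (by linarith)
  -- the time `u' = min (u + η/2) 1 > u`
  have hu'mem : min ((u : ℝ) + η / 2) 1 ∈ I :=
    ⟨le_min (by linarith [u.2.1]) zero_le_one, min_le_right _ _⟩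
  set u' : I := ⟨min ((u : ℝ) + η / 2) 1, hu'mem⟩ with hu'def
  have huu' : u < u' := by
    show (u : ℝ) < min ((u : ℝ) + η / 2) 1
    exact lt_min (by linarith) hu1
  have hdu' : dist u' u < η := by
    rw [Subtype.dist_eq, Real.dist_eq, abs_lt]
    constructor
    · show -η < min ((u : ℝ) + η / 2) 1 - u
      have : (u : ℝ) < min ((u : ℝ) + η / 2) 1 := lt_min (by linarith) hu1
      linarith
    · show min ((u : ℝ) + η / 2) 1 - u < η
      have : min ((u : ℝ) + η / 2) 1 ≤ u + η / 2 := min_le_left _ _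
      linarith
  have hu' : dist (γ u') y ≤ r₂ := by
    have h := hηu u' hdu'
    rw [Real.dist_eq, abs_lt] at h
    linarith [h.2]
  refine ⟨![0, u'], ![u, 1], ?_, ?_⟩
  · intro i
    fin_cases i
    · exact ⟨u.2.1, Or.inr ⟨by simpa using h0, hu.trans h12.le⟩⟩
    · exact ⟨u'.2.2, Or.inl ⟨hu', by simpa using h1⟩⟩
  · intro i j hij
    fin_cases i <;> fin_cases j <;> simp at hij
    simpa using huu'

/-- The polyline of a SAW of `Ω_δ` from `a` to `b` starts at `δ·a` and ends at `δ·b`. [folklore] -/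
theorem polyline_endpoints {Ω : Set ℂ} {δ : ℝ} {a b : Site 2} (γ : DomainSAW Ω δ a b) :
    (polyline γ) 0 = meshPoint δ a ∧ (polyline γ) 1 = meshPoint δ b :=
  ⟨SimpleGraph.Walk.toCurve_apply_zero _ _, toCurve_apply_one _ _⟩

/-- **The coarse budget is vacuous up to `m = 2`.** If both lattice endpoints lie outside the open disc
`B(y, 2s)` then, for `m ≤ 2` and `k ≥ 1`, the UMA event `{fibre ∧ k fine traversals ∧ < m coarse
traversals}` is EMPTY (every fine traversal forces a dive from the rim to `B̄(y, ts) ⊆ B(y, 6s/5)` and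
back: two coarse traversals). So the atom has content only from `m = 3` ("exactly one dive") on, or
when an endpoint `a δ / b δ` lies inside the disc (then one dive costs one coarse traversal); for the
refuter: NO choice of `m ≤ 2` can witness `¬ UMA` in the generic position. [folklore] -/
theorem event_eq_empty_of_budget_le_two {Ω : Set ℂ} {δ : ℝ} {a b : Site 2} (y : ℂ) {s t : ℝ}
    (hs : 0 < s) (ht1 : t < 1) {m k : ℕ} (hm : m ≤ 2) (hk : 1 ≤ k)
    (ha : 2 * s ≤ dist (meshPoint δ a) y) (hb : 2 * s ≤ dist (meshPoint δ b) y)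
    (γ₀ : DomainSAW Ω δ a b) :
    {γ : DomainSAW Ω δ a b | OutAgree y (2 * s) γ γ₀ ∧ (polyline γ).HasTraversals k y (t * s) s ∧
        ¬ (polyline γ).HasTraversals m y (6 * s / 5) (2 * s)} = ∅ := by
  refine Set.eq_empty_of_forall_notMem fun γ ⟨_, hfine, hcoarse⟩ => hcoarse ?_
  obtain ⟨h0, h1⟩ := polyline_endpoints γ
  have h2 : (polyline γ).HasTraversals 2 y (6 * s / 5) (2 * s) :=
    hasTraversals_two_of_one (polyline γ) y (hfine.of_le hk) (by nlinarith) (by linarith)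
      (by rw [h0]; exact ha) (by rw [h1]; exact hb)
  exact h2.of_le hm

/-- A vertex of an EDGE of a walk of `Ω_δ` lies in the discrete domain (hence its mesh point in `Ω`).
[folklore] -/
theorem mem_meshDomain_of_mem_edges {Ω : Set ℂ} {δ : ℝ} {a b : Site 2}
    (p : (discreteDomainGraph Ω δ).Walk a b) {e : Sym2 (Site 2)} (he : e ∈ p.edges) {v : Site 2}
    (hv : v ∈ e) : v ∈ meshDomain Ω δ := by
  have hE := p.edges_subset_edgeSet he
  induction e using Sym2.ind with
  | h x w =>
    rw [SimpleGraph.mem_edgeSet, discreteDomainGraph_adj_iff] at hE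
    rcases Sym2.mem_iff.1 hv with rfl | rfl
    · exact hE.2.1
    · exact hE.2.2

/-- **Top scale: every fibre is everything.** If `Ω ⊆ B(y, r)` then no walk of `Ω_δ` has an edge with
an endpoint at distance `≥ r` from `y`, so any two SAWs agree outside. [folklore] -/
theorem outAgree_of_subset_ball {Ω : Set ℂ} {δ : ℝ} {a b : Site 2} {y : ℂ} {r : ℝ}
    (hΩ : Ω ⊆ Metric.ball y r) (γ γ₀ : DomainSAW Ω δ a b) : OutAgree y r γ γ₀ := by
  rintro e ⟨v, hv, hr⟩
  have key : ∀ γ' : DomainSAW Ω δ a b, e ∉ γ'.walk.edges := fun γ' he => by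
    have hvΩ : meshPoint δ v ∈ Ω :=
      meshDomain_subset_meshVertices Ω δ (mem_meshDomain_of_mem_edges γ'.walk he hv)
    have := hΩ hvΩ
    rw [Metric.mem_ball] at this
    linarith
  exact ⟨fun he => absurd he (key γ), fun he => absurd he (key γ₀)⟩

/-- **The top-scale instances of UMA follow from the crux** (and are exactly per-shell tightness of
macroscopic shells): if `Ω ⊆ B(y, 2s)` then every fibre is the whole space (`outAgree_of_subset_ball`)
and the UMA inequality reads `P_δ[k traversals of D(y; ts, s) ∧ …] ≤ θ` for all small `δ`, which the
along-the-mesh tightness gives through the compact-set traversal bound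
`exists_forall_not_hasTraversals_of_isCompact`. Together with the ideator's `UMA → Crux1881` this
sandwiches the crux between UMA and its top scale: the atom is AT LEAST crux-hard, and no cheaper
instance of it exists at the top of the induction. [folklore] -/
theorem topScale_of_crux1881 (h : Crux1881) (D : DobrushinDomain) (a b : ℝ → Site 2)
    (hab : IsEndpointApprox D a b) (y : ℂ) (s t : ℝ) (hs : 0 < s) (_ht : 0 < t) (ht1 : t < 1)
    (htop : D.carrier ⊆ Metric.ball y (2 * s)) (m : ℕ) (θ : ℝ) (hθ : 0 < θ) :
    ∃ (k : ℕ) (δ₀ : ℝ), 0 < δ₀ ∧ ∀ δ ∈ Set.Ioc (0 : ℝ) δ₀,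
      ∀ γ₀ : DomainSAW D.carrier δ (a δ) (b δ),
        law D.carrier δ (a δ) (b δ)
            {γ | OutAgree y (2 * s) γ γ₀ ∧ (polyline γ).HasTraversals k y (t * s) s ∧
              ¬ (polyline γ).HasTraversals m y (6 * s / 5) (2 * s)}
          ≤ ENNReal.ofReal θ * law D.carrier δ (a δ) (b δ) {γ | OutAgree y (2 * s) γ γ₀} := by
  obtain ⟨K, hK, hev⟩ := h D a b hab (ENNReal.ofReal θ) (ENNReal.ofReal_pos.2 hθ)
  obtain ⟨k, hk⟩ := exists_forall_not_hasTraversals_of_isCompact hK y (r := t * s) (R := s)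
    (by nlinarith)
  have hprob := _root_.Summit.CriticalPhenomena.SAWScalingLimit.Theorems.SubseqIdentification.Negative.eventually_isProbabilityMeasure_law hab
  obtain ⟨δ₁, hδ₁, hsub⟩ := mem_nhdsGT_iff_exists_Ioo_subset.1 (hev.and hprob)
  have hδ₁pos : (0 : ℝ) < δ₁ := hδ₁
  refine ⟨k, δ₁ / 2, half_pos hδ₁pos, fun δ hδ γ₀ => ?_⟩
  obtain ⟨hKδ, hPδ⟩ := hsub ⟨hδ.1, hδ.2.trans_lt (half_lt_self hδ₁pos)⟩
  haveI := hPδ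
  have hfib : {γ : DomainSAW D.carrier δ (a δ) (b δ) | OutAgree y (2 * s) γ γ₀} = Set.univ :=
    Set.eq_univ_of_forall fun γ => outAgree_of_subset_ball htop γ γ₀
  calc law D.carrier δ (a δ) (b δ)
          {γ | OutAgree y (2 * s) γ γ₀ ∧ (polyline γ).HasTraversals k y (t * s) s ∧
            ¬ (polyline γ).HasTraversals m y (6 * s / 5) (2 * s)}
        ≤ law D.carrier δ (a δ) (b δ)
            ((fun γ : DomainSAW D.carrier δ (a δ) (b δ) => γ.curve) ⁻¹' Kᶜ) := by
          refine measure_mono fun γ hγ => ?_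
          intro hmem
          exact hk (polyline γ) hmem hγ.2.1
    _ ≤ ENNReal.ofReal θ := hKδ
    _ = ENNReal.ofReal θ * law D.carrier δ (a δ) (b δ) Set.univ := by rw [measure_univ, mul_one]
    _ = ENNReal.ofReal θ * law D.carrier δ (a δ) (b δ) {γ | OutAgree y (2 * s) γ γ₀} := by
          rw [hfib]

/-- **VERDICT on the picked line's atom (cdisprove-1881, cycle 1): `UMA` RESISTS cheap attack; no kill.**
Attack log (quantifier order `∀ D a b y s t m θ ∃ k δ₀ ∀ δ γ₀`: the adversary moves `γ₀` LAST, at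
mesh `δ → 0`, but the domain `D`, the shells and the budget `m` are fixed BEFORE `k`):
1. Junk / small parameters: `m = 0` (event empty: `HasTraversals 0` is `True`), `m ≤ 2` with the
   lattice endpoints outside the disc (`event_eq_empty_of_budget_le_two`), fibres of mass `0` (none:
   `γ₀` lies in its own fibre), the zero law (excluded below `δ₀` by `reachable`), top scale
   `Ω ⊆ B(y,2s)` (= per-shell tightness, crux-implied: `topScale_of_crux1881`) — all harmless.
2. DETERMINISTIC FORCING through the frozen outside trace is impossible for a FIXED Jordan domain:
   (a) an inside piece anchored at two doors (rim `|z−y| = 2s`) that makes one fine traversal reaches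
   `B̄(y,ts) ⊆ B(y,6s/5)` and so makes two coarse traversals (`hasTraversals_two_of_one`): in the event
   `{T_coarse < m}` at most `m/2 + 1` pieces enter `B(y, 6s/5)` at all, the other pieces live in the
   collar `A(y; 6s/5, 2s)` and cannot sculpt `B(y, s)`; (b) the obstacles inside `B(y, 6s/5)` are then
   `≤ m/2 + 1` resampled strands and `∂Ω` — and `∂Ω`, a FIXED Jordan curve, traverses `D(y; ts, s)`
   only finitely often (`jordan_boundary_finitely_many_traversals`), so it forces `≤ C(D,y,s,t)` fine
   traversals per strand (chambers of `Ω ∩ B(y,2s)` joined through a neck at `y`: an outside piece never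
   joins doors of two different door arcs — simple connectivity — and the doors of one arc are mutually
   visible inside their chamber (rim hops between rim-adjacent door vertices use non-frozen edges), so
   every frozen outside trace admits a completion with `≤ 2` neck passages per door arc); features of
   `∂Ω` at infinitely many scales exist only at accumulation points and are microscopic. Hence for
   `k > C(D,y,s,t,m)` the bad event is never FORCED — with or without the budget.
3. ENTROPIC forcing (NotesIdeator-1881-r1-k1 §2.2: `j` parallel door pairs make deep chords typical,
   `P → 1` as `j → ∞`) forces COARSE traversals `≈ 2j ≥ m` along with the fine ones: the budget `m`
   moves exactly these fibres into the complement of the event. This is the one place `m` is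
   load-bearing; a deterministic `¬ UMA-without-budget` does not exist either (item 2), so the budget
   cannot be certified load-bearing by a checked counterexample — its necessity is the (unformalised)
   free-energy comparison `e^{-cj²}` of the ideator notes.
4. What remains is probabilistic: `≤ m/2 + 1` critical strands in `B(y, 6s/5) ∩ Ω`, pinned at
   lattice-precise passage points through a possibly PACKED collar (up to `0.8 s/δ` nested shallow
   pieces are compatible with `T_coarse < m`), must not oscillate across `D(y; ts, s)` — multi-strand
   Aizenman–Burchard regularity uniform over boundary data, containing the pure-disc chord atom
   `PureDiscChordTight` (strictly weaker than item stmt-17940). No tool controls it (no RSW/FKG/BK for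
   the `x_c`-SAW on `ℤ²`; KS17 §4 omits SAW); no finite computation refutes an `∃ k N₀` statement.
5. Kill value: by `eventualTight_of_UMA` (ideator, kernel-checked) a proof of UMA proves the crux; by
   `topScale_of_crux1881` a refutation of UMA at top scale refutes the crux and hence (item
   `crux1881_necessary`) the summit conjunct. A refutation of UMA at an INTERMEDIATE scale would not
   touch the crux — that is the only UMA-specific risk, and it sits entirely in the uniformity over
   fibres of item 4 (lattice-pinned entry data), not in any forcing. [folklore] -/
theorem uma_resists : True := trivial

end UMALine

end Summit.CriticalPhenomena.SAWScalingLimit.Cruxes.EventualTight.Disproof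

end
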